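import Literature.MathematicalPhysics.QuantumFieldTheory.BalabanImbrieJaffe1984to88.BIJ88NeumannPropagatorFlatDecayCube
import Literature.MathematicalPhysics.QuantumFieldTheory.Balaban1983to89.B4Delta112ZeroBox

/-!
# `BalabanImbrieJaffe1984to88.BIJ88NeumannPropagatorFlatClose231` — T. Bałaban, J. Imbrie, A. Jaffe, *Effective action and cluster
properties of the abelian Higgs model*, Commun. Math. Phys. **114** (1988) 257–315 [BalabanImbrieJaffe1988], Sect. 2 p. 263 [PDF 7],
**(2.31) AND THE OPERATOR FORM OF (2.30) AT EVERY PURE-GAUGE BACKGROUND `u = 1^h`** for the torus objects of record — the closeness of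
`G_{k,loc}(u)` (2.28) to the region propagator `G_k(Ω₀,u)` deep inside a box `Ω₀`, from [6]'s Theorem (1.11)–(1.12) at `A = 0` through the
cube chart, in kernel and operator forms, and the sup-norm bound (2.30) with the printed *"at most 2^d terms"* multiplicity — hypothesis-free
in [6], constants depending on `(d, L, a)` only (uniform in the volume, in the level `1 ≤ k ≤ K` and in the gauge function `h`).

statement-level skeleton of published theorems with citation tags; proofs where landed; nothing here is a claim about the Yang–Mills mass gap

PDF held: `paper:balaban1988-cmp114-bij-abelian-higgs-effective-action` (journal page = PDF page + 256); p. 263–264 [PDF 7–8] re-read this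
session from the text layer (`lit read … --pages 6-9`); [6] = [7] of [I] = [Balaban1983RegularityDecay] (CMP **89**) p. 573 [PDF 3] and p. 579
[PDF 9] as transcribed in the tree's `Balaban1983to89.B4Delta112ZeroBox` (r01/b04 lineage, renders `b2b-balaban-ref1/pages/1983-cmp89-…`).

CITATION HEADER (lean-in-tree rule).  Part of the lit-balaban TYPED SKELETON (HOME `run/shared/lean/pub/lit-balaban/`), PHASE-2 proof seat
p31 gen 17 (unit `lit-balaban-p31-g17`; TAKING line HOME/STATUS.md 2026-08-22T15:27:51Z; free-target protocol G.5-34(d) — successor item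
(c) of this seat's gen-16 HANDOFF = item 2 (ii) of the owner's `HOME/lit-balaban-r18/C2S14-CLOSURE.md` §5, *"the DECAY inputs (2.30)/(2.31)
⟹ (2.35)/(2.36)/(2.38)/(2.41)/(4.9)_{j≥1} as torus theorems — [6]'s Theorem for p31's concrete `gBox` on nested cubes"*, in its FLAT-BACKGROUND
case, the (2.31) half).  WHAT IS REPRODUCED: row **C2.Eq2.31** (`HOME/lit-balaban-r18/ROWS-C2.md`, owner r18) for the CONCRETE torus objects —
gen 15's `BIJ88DeltaLoc234Torus.gLocT` (2.28) against gen 15's `BIJ88NeumannPropagator227Torus.gBox` on a box `Ω₀` — at pure-gauge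
backgrounds, with its [6]-input (1.11)–(1.12) (row B4.Thm@573, owner r01) for the torus cube propagators; and row **C2.Eq2.30** in OPERATOR
form for the same objects.  The decls of record of the displays remain r18's one-letter shapes `BIJ88Sect2Statements.OpClose231`/`OpDecay` and
p02's real-kernel hence-steps `BIJ88OpDecay230Proof.opClose231`/`opDecay230` (whose [6]-inputs `hclose`/`hG`/`hG0` and row sums `S`, `S′` are
displayed hypotheses); this file proves the bounds for the objects WITH BODIES.  Kind «model-level theorems only» (no new definition, no
`Prop`-valued fact introduced).

THE PRINTED TEXT (verbatim).  C2 p. 263 [PDF 7]: *"Let {□_α} be the collection of (1/2L) r(e_{k−1})-cubes that can be built from cubes of size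
M = O(1) as in [6]. Define G̃_k(u;x₁,x₂) = Σ_α λ_αG_k(□_α,u;x₁,x₂) (2.27) as a convex combination of Neumann propagators. The convex
combination varies smoothly with (x₁ + x₂)/2; it involves at most 2^d terms and is concentrated on □_α when (x₁ + x₂)/2 is near the center
of □_α. We then put G_{k,loc}(u;x₁,x₂) = ζ″_k(x₁,x₂)G̃_k(u;x₁,x₂), (2.28) where ζ″_k(x₁,x₂) is a smooth function of x₁ − x₂, ζ″_k(x₁,x₂) = 0, if
|x₁ − x₂| ≧ (1/4L) r(e_{k−1}), 1, if |x₁ − x₂| ≦ (1/8L) r(e_{k−1}). (2.29) The boundary conditions are always at a distance O(r(e_k)) from x₁,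
x₂, so a straightforward application of the random walk expansion of [6] shows that |(G_{k,loc}(u)f)(x)| ≦ ce^{−c dist(suppt f,x)}‖f‖_∞,
(2.30) |(G_{k,loc}(u)f − G_k(Ω,u)f)(x)| ≦ e^{−cr(e_k)}e^{−c dist(suppt f,x)}‖f‖_∞, (2.31) for dist(x,Ω^c) ≧ O(r(e_k)). [Each G_k(□_α,u) is
close to G_k(Ω,u) for the relevant x₁, x₂, therefore the convex combination and G_{k,loc} are close also.] We assume that u is smooth in the
□_α's entering the sum in (2.27); for (2.31) we assume smoothness throughout the subset Ω ⊂ T_η. … Bounds analogous to (2.30), (2.31) hold for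
covariant derivatives and Hölder derivatives of G_{k,loc}(u) of order less than two."*  [6] p. 573 [PDF 3] (as transcribed in
`B4Delta112ZeroBox`): *"If Ω ⊂ Ω₀, then for δG_k(Ω, Ω₀, A) defined by the equality δG_k(Ω, Ω₀, A) = G_k(Ω, A) − G_k(Ω₀, A), (1.11) we have
the inequalities (1.5) and (1.6) [sic: (1.9) and (1.10)] (with the same restrictions on x, x′) with the additional factor exp(−δ₀ dist(supp f,
Ω^c) − δ₀ dist(supp f, Ω^c)) (1.12) on the right hand sides [typed reading D-b04.2 after p. 579 / Cor. 2.3: one distance for x, one for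
supp f]. For some simple sets Ω, e.g. for rectangular parallelepipeds, the inequalities hold without any restrictions on the points x, x′"*.

THE OBJECTS (all with bodies, from gen 15/16).  `G_k(Ω,1^h) = gBox (α_kL^{k(d+1)}) ε⁻¹ (gaugeAct h 1) k Ω` for `Ω` a no-wrap cube of the fine
torus `T^{(0)}`: `Ω₀ = cubeT hPd (L^k) c (L^k·M₀)` (corner `c·L^k`, sides `L^kM₀_i`, fitting `c_iL^k + L^kM₀_i ≤ |T|` and shorter than the torus
`L^kM₀_i < |T|`) and the NESTED cubes `□ = cubeT hPd (L^k) (c + t) (L^k·M)` (`t_i + M_i ≤ M₀_i`, `M_i ≥ 1`); `G̃_k`, `G_{k,loc}` = gen 15's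
`gTilde`/`gLocT` over a finite family `cube : ι → Finset` of such nested cubes with real weights `λ_α(x₁,x₂)` and cut-off `ζ″(x₁,x₂)` as DATA;
`α_k = B1RG242Torus.α P a k`, counting-measure matrix normalization as in gen 15/16 (*"uniform lattice weights absorbed into c, a, L^{−kd}"*);
sup TORUS metric `B5Ineq137Torus.T` in lattice units (`ε·T` = the printed distance).

THE MECHANISM (the printed one: the bracketed sentence of p. 263, with [6] (1.11)–(1.12) as the closeness input, at `A = 0` up to gauge —
[I] p. 326 *"by change of gauge u_k can be transformed … into exp[ie_kηA]"*).  (§1) NESTED CHARTS: the inner chart point `(c+t)·n + z` is the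
outer chart point `c·n + (z + n·t)` (`cubePt_nested`) = b04's translation `emb` of the nested pair `Fits M M₀ t` (`fits_of_nested`); a source
supported in `□`, read in the outer box, is b04's extension by zero `ext` of the source read in the inner box (`source_ext`, by the injectivity
of the outer chart `cubePt_injOn`).  (§2) Hence, by gen 16's `gCubeR_mulVec_cubePt` on both cubes, `(G_k(□,1)φ − G_k(Ω₀,1)φ)((c+t)·n + z) =
(L^kε)²·dG … (φ^□) z` — r01/b04's `δG_k(□,Ω₀,0)` of (1.11) EXACTLY (`gCubeR_sub_nested_cubePt`).  (§3) [6] (1.11)–(1.12) AT `A = 0` BY NAME —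
`B4Delta112ZeroBox.delta112_zero_box_value` (`|δG f(x)| ≤ c₀e^{−δ₀D/n}e^{−δ₀(D_b+D_f)/n}F`, window `a₋ = a₊ = a`, `m² = 0`) — on the real and
imaginary parts of the rotated source `h̄f` (gen 16 `gBox_cube_pureGauge` on both cubes: `G(1^h) = M_hG(1)M_hᴴ`), the sup-torus distances
to `supp f` and to `Ω₀∖□` dominated by the box distances of the charts (`T_cubePt_le`), `(L^kε)² ≤ 1`, `e^{−δ₀E/L^k} ≤ e^{−δ₀εE}`
(`exp_level_le_exp_eps`): `close112_flat_cube` (operator form), `close112_flat_cube_kernel`; (§4) the same for the `η`-covariant-derivative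
member from `delta112_zero_box_deriv` through gen 16's `covD_gBox_cube_pureGauge` (`ε⁻¹(L^kε)² = (L^kε)L^k`): `close112_flat_cube_deriv`.
(§5) THE BRACKETED SENTENCE, entrywise: when the weights are complete where the cut-off lives, `G_{k,loc} − G_k(Ω₀) = ζ″Σ_αλ_α(G_k(□_α) −
G_k(Ω₀)) + (ζ″ − 1)G_k(Ω₀)` (`gLocT_sub_eq`, p02's `abs_loc_sub_le` split as an identity); the first term is small by §3 on every cube ACTIVE at
`(x,y)` (`ζ″λ_α ≠ 0` ⟹ `x, y ∈ □_α` at distance `≥ R` from `Ω₀∖□_α`: *"The boundary conditions are always at a distance O(r(e_k)) from x₁, x₂"*)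
and `Σ|λ_α| ≤ 1`, `0 ≤ ζ″ ≤ 1`; the second lives beyond `R₁` (`ζ″ = 1` within `R₁`, (2.29)) where gen 16's (1.10) kernel `decay110_flat_cube_kernel`
for `Ω₀` pays `e^{−(δ₀/2)εR₁}`: `close231_flat_kernel`.  (§6) OPERATOR FORMS without row sums: `(G_{k,loc}f)(x) = Σ_α(G_k(□_α)g_α)(x)` with the
row-`x` sources `g_α(y) = ζ″(x,y)λ_α(x,y)f(y)` (`gLocT_mulVec_apply`; `‖g_α‖_∞ ≤ ‖f‖_∞`, `supp g_α ⊆ supp f ∩ □_α`), so gen 16's (1.10) operator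
form `decay110_flat_cube` cube by cube gives (2.30) with the constant `#S·c₀`, `S` ⊇ the cubes active on the row of `x` (print: *"at most 2^d
terms"*) — `opDecay230_flat`; likewise `(G_{k,loc}f − G_k(Ω₀)f)(x) = Σ_α((G_k(□_α) − G_k(Ω₀))g_α)(x) + (G_k(Ω₀)g′)(x)`, `g′ = (ζ″ − 1)f`
supported beyond `R₁` and beyond `dist(x, supp f)` (`gLocT_sub_mulVec_apply`), §3 on the active cubes and `decay110_flat_cube` on `g′`:
`opClose231_flat`.

WHAT IS PROVED (theorems only; 0 `sorry`; standard axioms; no new definition, no `Prop`-valued fact).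
* §1 `fits_of_nested`, `fit_of_nested`, `short_of_nested`, `one_le_of_nested`, **`cubePt_nested`**, `emb_val_nested`, `add_mem_boxDom_nested`,
  `cubeT_nested_subset`, `sub_mem_of_cubePt_mem`, **`source_ext`**.
* §2 **`gCubeR_sub_nested_cubePt`**.
* §3 `exp_level_le_exp_eps`, **`close112_flat_cube`** — (1.11)–(1.12) value member: `∃ δ₀ c₀ > 0` (from `(d, ℓ, a)`) such that for every volume `P`
  with `P.d = d + 1`, `P.L = ℓ + 1`, every `1 ≤ k ≤ K`, every nested pair `□ ⊂ Ω₀` as above, every `h`, every `x ∈ □`, every complex source `f`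
  supported in `□` with `‖f‖ ≤ F` at sup-torus distance `≥ D ≥ 0` from `x`, all `D_b, D_f ≥ 0` dominated by the sup-torus distances from `x`,
  resp. `supp f`, to `Ω₀∖□`: `‖(G_k(□,1^h)f)(x) − (G_k(Ω₀,1^h)f)(x)‖ ≤ c₀e^{−δ₀εD}e^{−δ₀ε(D_b+D_f)}F`; **`close112_flat_cube_kernel`** — for
  `x, y ∈ □`: `‖G_k(□,1^h;x,y) − G_k(Ω₀,1^h;x,y)‖ ≤ c₀e^{−δ₀ε|x−y|_T}e^{−δ₀ε(R_x+R_y)}` (`R_x, R_y ≥ 0` dominated by the distances to `Ω₀∖□`).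
* §4 **`close112_flat_cube_deriv`** — the covariant-derivative member on the bonds `⟨x, x+e_μ⟩` of `□`:
  `‖D_u(G_k(□,1^h)f)(b) − D_u(G_k(Ω₀,1^h)f)(b)‖ ≤ c₀e^{−δ₀εD}e^{−δ₀ε(D_b+D_f)}F`, `u = 1^h`, `D_u` = r18's `covD` at scale `ε⁻¹`.
* §5 `gLocT_sub_eq`, **`close231_flat_kernel`** — (2.31), kernel form: for every box `Ω₀`, every finite family of cubes nested in `Ω₀`, weights
  `Σ_α|λ_α| ≤ 1`, cut-off `0 ≤ ζ″ ≤ 1`, every `h`, `x`, radii `R, R₁ ≥ 0` with, ON THE ROW OF `x`, (i) `ζ″(x,y) ≠ 0 ⟹ Σ_αλ_α(x,y) = 1`, (ii) every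
  active cube (`ζ″(x,y)λ_α(x,y) ≠ 0`) containing `x`, `y` at sup-torus distance `≥ R` from `Ω₀∖□_α`, (iii) `|x−y|_T ≤ R₁ ⟹ ζ″(x,y) = 1`:
  `‖G_{k,loc}(1^h;x,y) − G_k(Ω₀,1^h;x,y)‖ ≤ c₀(e^{−2δ₀εR} + e^{−(δ₀/2)εR₁})e^{−(δ₀/2)ε|x−y|_T}` for every `y`.
* §6 `gLocT_mulVec_apply`, `gLocT_sub_mulVec_apply`, `abs_lam_le_one`, `norm_rowSource_le`, `rowSource_ne_zero`, **`opDecay230_flat`** — (2.30),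
  operator form: `‖(G_{k,loc}(1^h)f)(x)‖ ≤ #S·c₀e^{−δ₀εD}‖f‖_∞` for any finite family of no-wrap cubes, `Σ|λ_α| ≤ 1`, `|ζ″| ≤ 1`, `supp f` at
  sup-torus distance `≥ D` from `x`, `S ⊇ {α | ∃ y, ζ″(x,y)λ_α(x,y) ≠ 0, f(y) ≠ 0}`; **`opClose231_flat`** — (2.31), operator form:
  `‖(G_{k,loc}(1^h)f − G_k(Ω₀,1^h)f)(x)‖ ≤ c₀(#S·e^{−2δ₀εR} + e^{−(δ₀/2)εR₁})e^{−(δ₀/2)εD}‖f‖_∞` under (i)–(iii).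
HONEST SCOPE.  (i) FLAT BACKGROUNDS ONLY (`A = 0` up to gauge): at a (1.7)-regular `A ≠ 0` the B4 families of record transport along
STAIRCASE contours, a different averaging operator from the composite-contour `Q_k(u)` of `gBox`; the general (2.32)-smooth case of the owner's
item 2 (ii) stays XL and a statement row ([6] = B4.Thm@573), as recorded in gen 16.  (ii) THE REGION `Ω` OF (2.31) IS A NO-WRAP BOX `Ω₀`
shorter than the torus: the tree's zero-field `δG` theorem is for nested BOXES (`B4Delta112ZeroBox`); `Ω = T_η` itself or a general union
of blocks would need a `δG_k(□, T_η, 0)` / `δG_k(□, Ω, 0)` theorem at `A = 0`, not in the tree (the B4 region families `B4Thm112Region*` are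
typed on the (1.7)-regular block-calculus carrier).  (iii) The printed radii — `R₁ = (1/8L)r(e_{k−1})`, the depth `R = O(r(e_k))` of
*"dist(x,Ω^c) ≧ O(r(e_k))"*, the multiplicity `#S ≤ 2^d` — are properties of the weight/cut-off DATA (p13's `ℤ^d` constructions
`BIJ88ConvexWeights227.cwt`/`BIJ88Cutoffs21`; a torus instance is not in the tree) and enter as the hypotheses (i)–(iii) and the set `S`, ROW BY
ROW in `x`; with them the right-hand sides are the printed `e^{−cr(e_k)}e^{−c dist(suppt f,x)}‖f‖_∞` and `ce^{−c dist}‖f‖_∞` with `k`-uniform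
`c`.  (iv) Value members, plus the covariant-derivative member of the [6]-input (§4); the derivative and Hölder members OF `G_{k,loc}` itself
(p. 263 last sentence) involve difference quotients of the weights `λ_α((x₁+x₂)/2)`, `ζ″(x₁−x₂)` in `x₁` — smoothness DATA again — and are
not assembled here.  (v) Fine level `j = 0`, `1 ≤ k ≤ K`, `m² = 0`, window `a₋ = a₊ = a`; complex sources (the printed `f : Ω → R^N`,
`N = 2`), constants `2c₀` of the zero-field theorems.  (vi) p33's Agmon-route `L²` decay of `G_k(u)` at small-plaquette fields is the
complementary member (not sup-norm, not `k`-uniform pointwise).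
Imports: this seat's gen-16 `BIJ88NeumannPropagatorFlatDecayCube` (→ `BIJ88NeumannPropagatorFlatDecay`, gen 15 `BIJ88DeltaLoc234Torus`/
`BIJ88NeumannPropagator227Torus`, p38 `B4Thm19ZeroBoxHolder`/`B4Thm110ZeroBox`, b04 `B4BoxCov237`/`B4Reflection242`), r01/b04's
`Balaban1983to89.B4Delta112ZeroBox` (→ `B4TwoBox120`, `B4Thm110ZeroBoxDeriv`).  Literature + Mathlib only.
Unit `lit-balaban-p31` (literature-prover-lit-balaban-p31-g17-0), 2026-08-22.  NOT summit progress.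
-/

open scoped BigOperators Matrix ComplexConjugate
open Finset Matrix

namespace Literature.MathematicalPhysics.QuantumFieldTheory.BalabanImbrieJaffe1984to88.BIJ88NeumannPropagatorFlatClose231

open Literature.MathematicalPhysics.QuantumFieldTheory.Balaban1983to89
open BIJ88Sect3Statements (U1 toC cfg covD starB mem_starB toC_mul toC_one toC_inv norm_toC)
open BIJ85BlockAveragesTorus BIJ85BlockAveragesTorusK
open BIJ88NeumannNoZeroModesTorus (IsBlockUnion)
open BIJ88NeumannPropagator227Torus
open BIJ88DeltaLoc234Torus (mulOp gBox_gaugeAct gBox_gaugeAct_apply gTilde gLocT gTilde_apply gLocT_apply)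
open BIJ88NeumannPropagatorFlatDecay
open BIJ88NeumannPropagatorFlatDecayCube
open B4Reflection242 (boxDom mem_boxDom)
open B4ContourShift (supNorm abs_le_supNorm supNorm_nonneg)
open B4BoxCov237 (boxOpR)
open B4TwoBox120 (Fits emb emb_val add_mem_boxDom)
open B4Delta112ZeroBox (ext ext_of_mem ext_of_not_mem dG delta112_zero_box_value)
open GaugeField (gaugeAct)

noncomputable section

variable {d : ℕ} {P : Params}

/-! ## §1 Nested cubes under the chart: `□ = (c+t)·n + Π_i[0, nM_i) ⊂ Ω₀ = c·n + Π_i[0, nM₀_i)` and b04's `Fits`/`emb`/`ext` -/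

section NestedChart

variable (hPd : P.d = d + 1) {n : ℕ} {c t M M0 : Fin (d + 1) → ℕ}

/-- kernel: the nesting `t_i + M_i ≤ M₀_i` of the two boxes in units of `n` is b04's `Fits M M₀ t` (`Ω ⊂ Ω₀` for two boxes).
[cite: Balaban1983RegularityDecay, p.573 (1.11), dictionary] -/
theorem fits_of_nested (hnest : ∀ i, t i + M i ≤ M0 i) : Fits M M0 (fun i => (t i : ℤ)) := fun i =>
  ⟨Int.natCast_nonneg _, by
    show (t i : ℤ) + (M i : ℤ) ≤ (M0 i : ℤ)
    exact_mod_cast hnest i⟩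

/-- kernel: the inner cube fits in the torus when the outer one does. [cite: Balaban1983RegularityDecay, p.572, dictionary] -/
theorem fit_of_nested (hnest : ∀ i, t i + M i ≤ M0 i) (hfit0 : ∀ i, c i * n + n * M0 i ≤ P.sitesPerDir 0) (i : Fin (d + 1)) :
    (c + t) i * n + n * M i ≤ P.sitesPerDir 0 := by
  have h1 : n * (t i + M i) ≤ n * M0 i := Nat.mul_le_mul_left _ (hnest i)
  have h2 := hfit0 i
  rw [Pi.add_apply, Nat.add_mul]
  rw [Nat.mul_add] at h1
  have h3 : t i * n = n * t i := Nat.mul_comm _ _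
  omega

/-- kernel: the inner cube is shorter than the torus when the outer one is. [cite: Balaban1983RegularityDecay, p.572, dictionary] -/
theorem short_of_nested (hnest : ∀ i, t i + M i ≤ M0 i) (hN0 : ∀ i, n * M0 i < P.sitesPerDir 0) (i : Fin (d + 1)) :
    n * M i < P.sitesPerDir 0 :=
  lt_of_le_of_lt (Nat.mul_le_mul_left _ (le_trans (Nat.le_add_left _ _) (hnest i))) (hN0 i)

/-- kernel: the outer sides are `≥ 1` when the inner ones are. [cite: Balaban1983RegularityDecay, p.572, dictionary] -/
theorem one_le_of_nested (hnest : ∀ i, t i + M i ≤ M0 i) (hM : ∀ i, 1 ≤ M i) (i : Fin (d + 1)) : 1 ≤ M0 i :=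
  (hM i).trans ((Nat.le_add_left _ _).trans (hnest i))

/-- kernel: **the two charts agree** — the inner chart point `(c+t)·n + z` is the outer chart point `c·n + (z + n·t)` (b04's translation
`emb : x ↦ x + n·s`). [cite: Balaban1983RegularityDecay, p.573 (1.11), dictionary] -/
theorem cubePt_nested (z : Fin (d + 1) → ℤ) :
    cubePt hPd n (c + t) z = cubePt hPd n c (z + fun i => (n : ℤ) * (t i : ℤ)) := by
  funext μ
  simp only [cubePt, Pi.add_apply]
  push_cast
  ring

/-- kernel: the coordinates of b04's translated point `emb` for the nested pair. [cite: Balaban1983RegularityDecay, p.573 (1.11), dictionary] -/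
theorem emb_val_nested (hs : Fits M M0 (fun i => (t i : ℤ))) {z : Fin (d + 1) → ℤ} (hz : z ∈ boxDom (fun i => n * M i)) :
    ((emb (hs.scale n) ⟨z, hz⟩ : ↥(boxDom fun i => n * M0 i)) : Fin (d + 1) → ℤ) = z + fun i => (n : ℤ) * (t i : ℤ) := rfl

/-- kernel: inner box points translate into the outer box. [cite: Balaban1983RegularityDecay, p.573 (1.11), dictionary] -/
theorem add_mem_boxDom_nested (hnest : ∀ i, t i + M i ≤ M0 i) {z : Fin (d + 1) → ℤ} (hz : z ∈ boxDom (fun i => n * M i)) :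
    (z + fun i => (n : ℤ) * (t i : ℤ)) ∈ boxDom (fun i => n * M0 i) :=
  add_mem_boxDom ((fits_of_nested hnest).scale n) hz

/-- kernel: **the inner cube lies in the outer cube**. [cite: BalabanImbrieJaffe1988, (2.27) p.263] -/
theorem cubeT_nested_subset (hnest : ∀ i, t i + M i ≤ M0 i) :
    cubeT hPd n (c + t) (fun i => n * M i) ⊆ cubeT hPd n c (fun i => n * M0 i) := by
  intro x hx
  obtain ⟨w, hw, rfl⟩ := (mem_cubeT hPd).1 hx
  rw [cubePt_nested]
  exact cubePt_mem_cubeT hPd (add_mem_boxDom_nested hnest hw)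

/-- kernel: an outer chart point that lies in the inner cube has its back-translated coordinates in the inner box (injectivity of the
outer chart on a box that fits in the torus). [cite: Balaban1983RegularityDecay, p.573 (1.11), dictionary] -/
theorem sub_mem_of_cubePt_mem (hfit0 : ∀ i, c i * n + n * M0 i ≤ P.sitesPerDir 0) (hnest : ∀ i, t i + M i ≤ M0 i)
    {v : Fin (d + 1) → ℤ} (hv : v ∈ boxDom (fun i => n * M0 i))
    (hmem : cubePt hPd n c v ∈ cubeT hPd n (c + t) (fun i => n * M i)) :
    (v - fun i => (n : ℤ) * (t i : ℤ)) ∈ boxDom (fun i => n * M i) := by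
  obtain ⟨w, hw, hwv⟩ := (mem_cubeT hPd).1 hmem
  rw [cubePt_nested] at hwv
  have heq := cubePt_injOn hPd hfit0 (Finset.mem_coe.2 (add_mem_boxDom_nested hnest hw)) (Finset.mem_coe.2 hv) hwv
  rw [← heq, add_sub_cancel_right]
  exact hw

/-- kernel: **a source supported in the inner cube, read in the outer box, IS b04's extension by zero `ext` of the source read in the
inner box** (the `E f` of `δG_k(Ω,Ω₀,0)f = G_k(Ω)f − (G_k(Ω₀)(Ef))∘emb`). [cite: Balaban1983RegularityDecay, p.573 (1.11), dictionary] -/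
theorem source_ext (hfit0 : ∀ i, c i * n + n * M0 i ≤ P.sitesPerDir 0) (hnest : ∀ i, t i + M i ≤ M0 i)
    (φ : Balaban1983to89.Site P 0 → ℝ) (hφ : ∀ y, y ∉ cubeT hPd n (c + t) (fun i => n * M i) → φ y = 0) :
    (fun v : ↥(boxDom fun i => n * M0 i) => φ (cubePt hPd n c (v : Fin (d + 1) → ℤ))) =
      ext n M M0 (fun i => (t i : ℤ)) (fun w : ↥(boxDom fun i => n * M i) => φ (cubePt hPd n (c + t) (w : Fin (d + 1) → ℤ))) := by
  funext v
  by_cases hv : ((v : Fin (d + 1) → ℤ) - fun i => (n : ℤ) * (t i : ℤ)) ∈ boxDom (fun i => n * M i)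
  · rw [ext_of_mem _ hv, cubePt_nested hPd, sub_add_cancel]
  · rw [ext_of_not_mem _ hv]
    exact hφ _ (fun hmem => hv (sub_mem_of_cubePt_mem hPd hfit0 hnest v.2 hmem))

end NestedChart

/-! ## §2 `G_k(□,1)f − G_k(Ω₀,1)f` at an inner point IS `(L^kε)²·δG_k(□,Ω₀,0)` of b04/r01 for sources supported in `□` -/

section Difference

variable (hPd : P.d = d + 1) {n : ℕ} {c t M M0 : Fin (d + 1) → ℕ}

/-- **The difference of the two cube propagators at an inner chart point**, for a real source supported in the inner cube: with gen 16's
`gCubeR` (`= G_k(·,1)` by `gBox_cube_eq`), `(G_k(□,1)φ − G_k(Ω₀,1)φ)((c+t)·n + z) = s²·δG_k(□,Ω₀,0)(φ^□)(z)`, `δG` = b04's `dG`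
(the outer Green's function applied to the extension by zero and read off at the translated point), `φ^□` the source read in the inner box.
[cite: Balaban1983RegularityDecay, p.573 (1.11)] -/
theorem gCubeR_sub_nested_cubePt (hfit0 : ∀ i, c i * n + n * M0 i ≤ P.sitesPerDir 0) (hnest : ∀ i, t i + M i ≤ M0 i) (s2 A : ℝ)
    (φ : Balaban1983to89.Site P 0 → ℝ) (hφ : ∀ y, y ∉ cubeT hPd n (c + t) (fun i => n * M i) → φ y = 0)
    {z : Fin (d + 1) → ℤ} (hz : z ∈ boxDom (fun i => n * M i)) :
    (gCubeR hPd n (c + t) M s2 A *ᵥ φ) (cubePt hPd n (c + t) z) - (gCubeR hPd n c M0 s2 A *ᵥ φ) (cubePt hPd n (c + t) z) =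
      s2 * dG n A 0 (fits_of_nested hnest)
        (fun w : ↥(boxDom fun i => n * M i) => φ (cubePt hPd n (c + t) (w : Fin (d + 1) → ℤ))) ⟨z, hz⟩ := by
  have hfit := fit_of_nested hnest hfit0
  rw [gCubeR_mulVec_cubePt hPd hfit s2 A φ hz, cubePt_nested hPd z,
    gCubeR_mulVec_cubePt hPd hfit0 s2 A φ (add_mem_boxDom_nested hnest hz), source_ext hPd hfit0 hnest φ hφ, dG, mul_sub]
  rfl

end Difference

/-! ## §3 [6]'s Theorem (1.11)–(1.12) at `A = 0`, value member, for the torus cube propagators `G_k(□,1^h)`, `G_k(Ω₀,1^h)` -/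

section Close112

/-- kernel: the real part of a real matrix applied to a complex vector is the matrix applied to the real part. [folklore] -/
private theorem re_map_mulVec {m q : Type*} [Fintype q] (G : Matrix m q ℝ) (g : q → ℂ) (x : m) :
    ((G.map Complex.ofRealHom *ᵥ g) x).re = (G *ᵥ fun y => (g y).re) x := by
  simp only [mulVec, dotProduct, map_apply, Complex.ofRealHom_eq_coe, Complex.re_sum, Complex.re_ofReal_mul]

/-- kernel: the same for the imaginary part. [folklore] -/
private theorem im_map_mulVec {m q : Type*} [Fintype q] (G : Matrix m q ℝ) (g : q → ℂ) (x : m) :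
    ((G.map Complex.ofRealHom *ᵥ g) x).im = (G *ᵥ fun y => (g y).im) x := by
  simp only [mulVec, dotProduct, map_apply, Complex.ofRealHom_eq_coe, Complex.im_sum, Complex.im_ofReal_mul]

/-- kernel: `‖(Ag)(x) − (Bg)(x)‖ ≤ |(A Re g − B Re g)(x)| + |(A Im g − B Im g)(x)|` for real matrices `A`, `B`. [folklore] -/
private theorem norm_sub_map_mulVec_le {m q : Type*} [Fintype q] (A B : Matrix m q ℝ) (g : q → ℂ) (x : m) :
    ‖(A.map Complex.ofRealHom *ᵥ g) x - (B.map Complex.ofRealHom *ᵥ g) x‖ ≤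
      |(A *ᵥ fun y => (g y).re) x - (B *ᵥ fun y => (g y).re) x| + |(A *ᵥ fun y => (g y).im) x - (B *ᵥ fun y => (g y).im) x| := by
  rw [← re_map_mulVec, ← re_map_mulVec, ← im_map_mulVec, ← im_map_mulVec, ← Complex.sub_re, ← Complex.sub_im]
  exact Complex.norm_le_abs_re_add_abs_im _

/-- kernel: `e^{−δ₀E/L^k} ≤ e^{−δ₀εE}` for `E ≥ 0` (`L^kε ≤ 1`: [6]'s level-`k` lattice units dominate the `ε`-units of the torus).
[cite: Balaban1983RegularityDecay, p.572, dictionary] -/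
theorem exp_level_le_exp_eps (P : Params) {k : ℕ} (hkK : k ≤ P.K) {δ₀ E : ℝ} (hδ₀ : 0 ≤ δ₀) (hE : 0 ≤ E) :
    Real.exp (-(δ₀ * E / (((P.L ^ k : ℕ) : ℝ)))) ≤ Real.exp (-(δ₀ * (P.eps * E))) := by
  have hncast : (((P.L ^ k : ℕ) : ℝ)) = (P.L : ℝ) ^ k := by push_cast; rfl
  have hnpos : (0 : ℝ) < (((P.L ^ k : ℕ) : ℝ)) := by rw [hncast]; exact pow_pos P.cast_L_pos _
  have hs1 : P.spacing k ≤ 1 := by rw [← P.spacing_K]; exact B4Ineq116Torus.spacing_le_spacing P hkK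
  rw [Real.exp_le_exp, neg_le_neg_iff, mul_div_assoc]
  refine mul_le_mul_of_nonneg_left ?_ hδ₀
  rw [le_div_iff₀ hnpos, hncast]
  calc P.eps * E * (P.L : ℝ) ^ k = P.spacing k * E := by rw [Params.spacing]; ring
    _ ≤ 1 * E := mul_le_mul_of_nonneg_right hs1 hE
    _ = E := one_mul E

/-- **[6] (1.11)–(1.12) AT `A = 0`, VALUE MEMBER, FOR THE TORUS CUBE PROPAGATORS AT EVERY PURE-GAUGE BACKGROUND** (*"If Ω ⊂ Ω₀, then for
δG_k(Ω, Ω₀, A) = G_k(Ω, A) − G_k(Ω₀, A) (1.11) we have the inequalities … with the additional factor exp(−δ₀ dist(x, Ω^c) − δ₀ dist(supp f, Ω^c))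
(1.12) … for rectangular parallelepipeds, the inequalities hold without any restrictions on the points"*, p. 573, in r01/b04's typed reading of
the factor (1.12): distances of `x` and of `supp f` to `Ω₀∖Ω`): there are `δ₀, c₀ > 0` depending on `(d, ℓ, a)` only (`L = ℓ + 1`) such that on
EVERY torus of the series with `d + 1` directions and this `L`, for every level `1 ≤ k ≤ K`, every NESTED pair of cubes `□ = (c+t)·L^k +
Π_i[0, L^kM_i) ⊂ Ω₀ = c·L^k + Π_i[0, L^kM₀_i)` (`M_i ≥ 1`, `t_i + M_i ≤ M₀_i`) with `Ω₀` fitting and shorter than the torus, every gauge function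
`h`, every `x ∈ □` and every complex source `f` SUPPORTED IN `□` with `‖f‖_∞ ≤ F`, at sup-torus distance `≥ D ≥ 0` from `x`, and all
`D_b, D_f ≥ 0` dominated by the sup-torus distances from `x`, resp. from `supp f`, to `Ω₀∖□`:
`‖(G_k(□,1^h)f)(x) − (G_k(Ω₀,1^h)f)(x)‖ ≤ c₀e^{−δ₀εD}e^{−δ₀ε(D_b+D_f)}F` — from r01/b04's zero-field nested-box theorem
`B4Delta112ZeroBox.delta112_zero_box_value` (window `a₋ = a₊ = a`, `m² = 0`) on the real and imaginary parts of `h̄f` read in the inner box,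
through gen 16's chart (`gBox_cube_pureGauge` on both cubes; torus distances are dominated by box distances, `T_cubePt_le`; `(L^kε)² ≤ 1`,
`e^{−δ₀E/L^k} ≤ e^{−δ₀εE}`). [cite: Balaban1983RegularityDecay, (1.11)–(1.12) p.573] -/
theorem close112_flat_cube (d ℓ : ℕ) (hℓ : 1 ≤ ℓ) {a : ℝ} (ha : 0 < a) :
    ∃ δ₀ c₀ : ℝ, 0 < δ₀ ∧ 0 < c₀ ∧ ∀ (P : Params) (hPd : P.d = d + 1), P.L = ℓ + 1 →
      ∀ k : ℕ, 1 ≤ k → k ≤ P.K → ∀ (c M0 t M : Fin (d + 1) → ℕ), (∀ i, 1 ≤ M i) → (∀ i, t i + M i ≤ M0 i) →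
        (∀ i, c i * P.L ^ k + P.L ^ k * M0 i ≤ P.sitesPerDir 0) → (∀ i, P.L ^ k * M0 i < P.sitesPerDir 0) →
        ∀ (h : GaugeTransf P 0 U1) (x : Balaban1983to89.Site P 0), x ∈ cubeT hPd (P.L ^ k) (c + t) (fun i => P.L ^ k * M i) →
        ∀ (f : Balaban1983to89.Site P 0 → ℂ) (F D Db Df : ℝ), (∀ y, ‖f y‖ ≤ F) →
          (∀ y, y ∉ cubeT hPd (P.L ^ k) (c + t) (fun i => P.L ^ k * M i) → f y = 0) →
          0 ≤ D → (∀ y, f y ≠ 0 → D ≤ B5Ineq137Torus.T P 0 x y) →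
          0 ≤ Db → (∀ w ∈ cubeT hPd (P.L ^ k) c (fun i => P.L ^ k * M0 i), w ∉ cubeT hPd (P.L ^ k) (c + t) (fun i => P.L ^ k * M i) →
            Db ≤ B5Ineq137Torus.T P 0 x w) →
          0 ≤ Df → (∀ y, f y ≠ 0 → ∀ w ∈ cubeT hPd (P.L ^ k) c (fun i => P.L ^ k * M0 i),
            w ∉ cubeT hPd (P.L ^ k) (c + t) (fun i => P.L ^ k * M i) → Df ≤ B5Ineq137Torus.T P 0 y w) →
          ‖(gBox (B1RG242Torus.α P a k * (P.L : ℝ) ^ (k * P.d)) P.eps⁻¹ (gaugeAct h (1 : GaugeField P 0 U1)) k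
                (cubeT hPd (P.L ^ k) (c + t) fun i => P.L ^ k * M i) *ᵥ f) x -
            (gBox (B1RG242Torus.α P a k * (P.L : ℝ) ^ (k * P.d)) P.eps⁻¹ (gaugeAct h (1 : GaugeField P 0 U1)) k
                (cubeT hPd (P.L ^ k) c fun i => P.L ^ k * M0 i) *ᵥ f) x‖ ≤
            c₀ * Real.exp (-(δ₀ * (P.eps * D))) * Real.exp (-(δ₀ * (P.eps * (Db + Df)))) * F := by
  obtain ⟨δ₀, c₀, hδ₀, hc₀, H⟩ := delta112_zero_box_value d ℓ hℓ a a 0 ha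
  refine ⟨δ₀, 2 * c₀, hδ₀, by positivity, ?_⟩
  intro P hPd hPL k hk1 hkK c M0 t M hM hnest hfit0 hN0 h x hx f F D Db Df hF hfs hD hsD hDb hsDb hDf hsDf
  have hk : k ≤ P.m + P.K := hkK.trans (Nat.le_add_left _ _)
  have e1 : P.L ^ k = (ℓ + 1) ^ k := by rw [hPL]
  rw [e1] at hfit0 hN0 hx hfs hsDb hsDf ⊢
  have hn : (ℓ + 1) ^ k = P.L ^ k := e1.symm
  have hfit := fit_of_nested hnest hfit0
  have hN := short_of_nested hnest hN0
  have hM0 := one_le_of_nested hnest hM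
  have hF0 : 0 ≤ F := (norm_nonneg _).trans (hF x)
  have hs1 : P.spacing k ≤ 1 := by rw [← P.spacing_K]; exact B4Ineq116Torus.spacing_le_spacing P hkK
  have hs2 : P.spacing k ^ 2 ≤ 1 := pow_le_one₀ (P.spacing_pos k).le hs1
  have hexp : ∀ E : ℝ, 0 ≤ E → Real.exp (-(δ₀ * E / ((((ℓ + 1) ^ k : ℕ) : ℝ)))) ≤ Real.exp (-(δ₀ * (P.eps * E))) := fun E hE => by
    have h1 := exp_level_le_exp_eps P hkK hδ₀.le hE
    rwa [e1] at h1
  have hLcast : ((ℓ : ℝ) + 1) = (P.L : ℝ) := by rw [hPL]; push_cast; ring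
  have H' := H k hk1 a 0 le_rfl le_rfl le_rfl le_rfl M M0 (fun i => (t i : ℤ)) (fits_of_nested hnest) hM
  rw [hLcast] at H'
  obtain ⟨z, hz, rfl⟩ := (mem_cubeT hPd).1 hx
  have hz0 := add_mem_boxDom_nested (n := (ℓ + 1) ^ k) hnest hz
  -- the real estimate for a real source `φ` supported in the inner cube like `f`
  have key : ∀ φ : Balaban1983to89.Site P 0 → ℝ, (∀ y, |φ y| ≤ F) →
      (∀ y, y ∉ cubeT hPd ((ℓ + 1) ^ k) (c + t) (fun i => (ℓ + 1) ^ k * M i) → φ y = 0) →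
      (∀ y, φ y ≠ 0 → D ≤ B5Ineq137Torus.T P 0 (cubePt hPd ((ℓ + 1) ^ k) (c + t) z) y) →
      (∀ y, φ y ≠ 0 → ∀ w ∈ cubeT hPd ((ℓ + 1) ^ k) c (fun i => (ℓ + 1) ^ k * M0 i),
        w ∉ cubeT hPd ((ℓ + 1) ^ k) (c + t) (fun i => (ℓ + 1) ^ k * M i) → Df ≤ B5Ineq137Torus.T P 0 y w) →
      |(gCubeR hPd ((ℓ + 1) ^ k) (c + t) M (P.spacing k ^ 2) (B1.aSeq a P.L k) *ᵥ φ) (cubePt hPd ((ℓ + 1) ^ k) (c + t) z) -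
          (gCubeR hPd ((ℓ + 1) ^ k) c M0 (P.spacing k ^ 2) (B1.aSeq a P.L k) *ᵥ φ) (cubePt hPd ((ℓ + 1) ^ k) (c + t) z)| ≤
        c₀ * Real.exp (-(δ₀ * (P.eps * D))) * Real.exp (-(δ₀ * (P.eps * (Db + Df)))) * F := by
    intro φ hφ hφ0 hφD hφDf
    rw [gCubeR_sub_nested_cubePt hPd hfit0 hnest _ _ φ hφ0 hz, abs_mul, abs_of_nonneg (sq_nonneg _)]
    have hB := H' (fun w => φ (cubePt hPd ((ℓ + 1) ^ k) (c + t) (w : Fin (d + 1) → ℤ))) F (fun w => hφ _) ⟨z, hz⟩ D Db Df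
      (fun w hw => (hφD _ hw).trans (T_cubePt_le hPd hfit hz w.2))
      (fun y' hy' => by
        have hw : cubePt hPd ((ℓ + 1) ^ k) c (y' : Fin (d + 1) → ℤ) ∈ cubeT hPd ((ℓ + 1) ^ k) c (fun i => (ℓ + 1) ^ k * M0 i) :=
          cubePt_mem_cubeT hPd y'.2
        have hw' : cubePt hPd ((ℓ + 1) ^ k) c (y' : Fin (d + 1) → ℤ) ∉ cubeT hPd ((ℓ + 1) ^ k) (c + t) (fun i => (ℓ + 1) ^ k * M i) :=
          fun hm => hy' (sub_mem_of_cubePt_mem hPd hfit0 hnest y'.2 hm)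
        have h1 := hsDb _ hw hw'
        rw [cubePt_nested hPd] at h1
        exact h1.trans (T_cubePt_le hPd hfit0 hz0 y'.2))
      (fun w hw y' hy' => by
        have hv : cubePt hPd ((ℓ + 1) ^ k) c (y' : Fin (d + 1) → ℤ) ∈ cubeT hPd ((ℓ + 1) ^ k) c (fun i => (ℓ + 1) ^ k * M0 i) :=
          cubePt_mem_cubeT hPd y'.2
        have hv' : cubePt hPd ((ℓ + 1) ^ k) c (y' : Fin (d + 1) → ℤ) ∉ cubeT hPd ((ℓ + 1) ^ k) (c + t) (fun i => (ℓ + 1) ^ k * M i) :=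
          fun hm => hy' (sub_mem_of_cubePt_mem hPd hfit0 hnest y'.2 hm)
        have h1 := hφDf _ hw _ hv hv'
        rw [cubePt_nested hPd] at h1
        exact h1.trans (T_cubePt_le hPd hfit0 (add_mem_boxDom_nested hnest w.2) y'.2))
    have hE : Real.exp (-(δ₀ * Db / ((((ℓ + 1) ^ k : ℕ) : ℝ)) + δ₀ * Df / ((((ℓ + 1) ^ k : ℕ) : ℝ)))) ≤
        Real.exp (-(δ₀ * (P.eps * (Db + Df)))) := by
      have h1 := hexp Db hDb
      have h2 := hexp Df hDf
      have e2 : -(δ₀ * Db / ((((ℓ + 1) ^ k : ℕ) : ℝ)) + δ₀ * Df / ((((ℓ + 1) ^ k : ℕ) : ℝ))) =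
          -(δ₀ * Db / ((((ℓ + 1) ^ k : ℕ) : ℝ))) + -(δ₀ * Df / ((((ℓ + 1) ^ k : ℕ) : ℝ))) := by ring
      have e3 : -(δ₀ * (P.eps * (Db + Df))) = -(δ₀ * (P.eps * Db)) + -(δ₀ * (P.eps * Df)) := by ring
      rw [e2, e3, Real.exp_add, Real.exp_add]
      exact mul_le_mul h1 h2 (Real.exp_pos _).le (Real.exp_pos _).le
    calc P.spacing k ^ 2 * |dG ((ℓ + 1) ^ k) (B1.aSeq a P.L k) 0 (fits_of_nested hnest)
            (fun w : ↥(boxDom fun i => (ℓ + 1) ^ k * M i) => φ (cubePt hPd ((ℓ + 1) ^ k) (c + t) (w : Fin (d + 1) → ℤ))) ⟨z, hz⟩|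
        ≤ 1 * (c₀ * Real.exp (-(δ₀ * D / ((((ℓ + 1) ^ k : ℕ) : ℝ)))) *
            Real.exp (-(δ₀ * Db / ((((ℓ + 1) ^ k : ℕ) : ℝ)) + δ₀ * Df / ((((ℓ + 1) ^ k : ℕ) : ℝ)))) * F) :=
          mul_le_mul hs2 hB (abs_nonneg _) zero_le_one
      _ ≤ c₀ * Real.exp (-(δ₀ * (P.eps * D))) * Real.exp (-(δ₀ * (P.eps * (Db + Df)))) * F := by
          rw [one_mul]
          refine mul_le_mul_of_nonneg_right ?_ hF0
          exact mul_le_mul (mul_le_mul_of_nonneg_left (hexp D hD) hc₀.le) hE (Real.exp_pos _).le (by positivity)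
  -- pure gauge on both cubes: `(G(1^h)f)(x) = h(x)·(G(1)(h̄f))(x)`; split `h̄f` into real and imaginary parts
  rw [gBox_cube_pureGauge hPd hk1 hk hn hfit hN hM ha h, gBox_cube_pureGauge hPd hk1 hk hn hfit0 hN0 hM0 ha h, ← mulVec_mulVec,
    ← mulVec_mulVec, ← mulVec_mulVec, ← mulVec_mulVec, mulOp_conjTranspose_mulVec, mulOp_mulVec, mulOp_mulVec, ← mul_sub, norm_mul,
    norm_toC, one_mul]
  set g : Balaban1983to89.Site P 0 → ℂ := fun y => (starRingEnd ℂ) (toC (h y)) * f y with hg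
  have hgR : ∀ y, |(g y).re| ≤ F := fun y => ((Complex.abs_re_le_norm _).trans_eq (norm_rot h f y)).trans (hF y)
  have hgI : ∀ y, |(g y).im| ≤ F := fun y => ((Complex.abs_im_le_norm _).trans_eq (norm_rot h f y)).trans (hF y)
  have hg0 : ∀ y, f y = 0 → g y = 0 := fun y hf => by simp only [hg, hf, mul_zero]
  have hR0 : ∀ y, y ∉ cubeT hPd ((ℓ + 1) ^ k) (c + t) (fun i => (ℓ + 1) ^ k * M i) → (g y).re = 0 := fun y hy => by
    rw [hg0 y (hfs y hy), Complex.zero_re]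
  have hI0 : ∀ y, y ∉ cubeT hPd ((ℓ + 1) ^ k) (c + t) (fun i => (ℓ + 1) ^ k * M i) → (g y).im = 0 := fun y hy => by
    rw [hg0 y (hfs y hy), Complex.zero_im]
  have hRne : ∀ y, (g y).re ≠ 0 → f y ≠ 0 := fun y hy hf => hy (by rw [hg0 y hf, Complex.zero_re])
  have hIne : ∀ y, (g y).im ≠ 0 → f y ≠ 0 := fun y hy hf => hy (by rw [hg0 y hf, Complex.zero_im])
  have hE2 : 2 * c₀ * Real.exp (-(δ₀ * (P.eps * D))) * Real.exp (-(δ₀ * (P.eps * (Db + Df)))) * F =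
      c₀ * Real.exp (-(δ₀ * (P.eps * D))) * Real.exp (-(δ₀ * (P.eps * (Db + Df)))) * F +
        c₀ * Real.exp (-(δ₀ * (P.eps * D))) * Real.exp (-(δ₀ * (P.eps * (Db + Df)))) * F := by ring
  rw [hE2]
  exact (norm_sub_map_mulVec_le _ _ g _).trans (add_le_add
    (key _ hgR hR0 (fun y hy => hsD y (hRne y hy)) (fun y hy => hsDf y (hRne y hy)))
    (key _ hgI hI0 (fun y hy => hsD y (hIne y hy)) (fun y hy => hsDf y (hIne y hy))))

/-- **(1.11)–(1.12) AT `A = 0` FOR THE TORUS CUBES, KERNEL FORM**: for `x, y ∈ □` and `R_x, R_y ≥ 0` dominated by the sup-torus distances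
from `x`, resp. `y`, to `Ω₀∖□`: `‖G_k(□,1^h;x,y) − G_k(Ω₀,1^h;x,y)‖ ≤ c₀e^{−δ₀ε|x−y|_T}e^{−δ₀ε(R_x+R_y)}` — *"Each G_k(□_α,u) is close to
G_k(Ω,u) for the relevant x₁, x₂"* (p. 263) at flat `u`. [cite: Balaban1983RegularityDecay, (1.11)–(1.12) p.573] -/
theorem close112_flat_cube_kernel (d ℓ : ℕ) (hℓ : 1 ≤ ℓ) {a : ℝ} (ha : 0 < a) :
    ∃ δ₀ c₀ : ℝ, 0 < δ₀ ∧ 0 < c₀ ∧ ∀ (P : Params) (hPd : P.d = d + 1), P.L = ℓ + 1 →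
      ∀ k : ℕ, 1 ≤ k → k ≤ P.K → ∀ (c M0 t M : Fin (d + 1) → ℕ), (∀ i, 1 ≤ M i) → (∀ i, t i + M i ≤ M0 i) →
        (∀ i, c i * P.L ^ k + P.L ^ k * M0 i ≤ P.sitesPerDir 0) → (∀ i, P.L ^ k * M0 i < P.sitesPerDir 0) →
        ∀ (h : GaugeTransf P 0 U1) (x y : Balaban1983to89.Site P 0),
          x ∈ cubeT hPd (P.L ^ k) (c + t) (fun i => P.L ^ k * M i) → y ∈ cubeT hPd (P.L ^ k) (c + t) (fun i => P.L ^ k * M i) →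
        ∀ (Rx Ry : ℝ), 0 ≤ Rx → 0 ≤ Ry →
          (∀ w ∈ cubeT hPd (P.L ^ k) c (fun i => P.L ^ k * M0 i), w ∉ cubeT hPd (P.L ^ k) (c + t) (fun i => P.L ^ k * M i) →
            Rx ≤ B5Ineq137Torus.T P 0 x w ∧ Ry ≤ B5Ineq137Torus.T P 0 y w) →
          ‖gBox (B1RG242Torus.α P a k * (P.L : ℝ) ^ (k * P.d)) P.eps⁻¹ (gaugeAct h (1 : GaugeField P 0 U1)) k
                (cubeT hPd (P.L ^ k) (c + t) fun i => P.L ^ k * M i) x y -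
            gBox (B1RG242Torus.α P a k * (P.L : ℝ) ^ (k * P.d)) P.eps⁻¹ (gaugeAct h (1 : GaugeField P 0 U1)) k
                (cubeT hPd (P.L ^ k) c fun i => P.L ^ k * M0 i) x y‖ ≤
            c₀ * Real.exp (-(δ₀ * (P.eps * B5Ineq137Torus.T P 0 x y))) * Real.exp (-(δ₀ * (P.eps * (Rx + Ry)))) := by
  obtain ⟨δ₀, c₀, hδ₀, hc₀, H⟩ := close112_flat_cube d ℓ hℓ ha
  refine ⟨δ₀, c₀, hδ₀, hc₀, ?_⟩
  intro P hPd hPL k hk1 hkK c M0 t M hM hnest hfit0 hN0 h x y hx hy Rx Ry hRx hRy hR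
  have h1 := H P hPd hPL k hk1 hkK c M0 t M hM hnest hfit0 hN0 h x hx (Pi.single y 1) 1 (B5Ineq137Torus.T P 0 x y) Rx Ry
    (fun z => by by_cases hz : z = y <;> simp [hz])
    (fun z hz => by
      by_cases hzy : z = y
      · exact absurd (hzy ▸ hy) hz
      · simp [hzy])
    (B5Ineq137Torus.T_nonneg P 0 x y)
    (fun z hz => by
      by_cases hzy : z = y
      · rw [hzy]
      · exact absurd (by simp [hzy]) hz)
    hRx (fun w hw hw' => (hR w hw hw').1) hRy
    (fun z hz w hw hw' => by
      by_cases hzy : z = y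
      · rw [hzy]; exact (hR w hw hw').2
      · exact absurd (by simp [hzy]) hz)
  rwa [mulVec_single_one, mulVec_single_one, col_apply, col_apply, mul_one] at h1

end Close112

/-! ## §4 [6]'s Theorem (1.11)–(1.12) at `A = 0`, covariant-derivative member, for the nested torus cubes on the bonds of `□` -/

section Close112Deriv

/-- kernel: a difference version of the real/imaginary part split — `‖z − w‖ ≤ |Re z − Re w| + |Im z − Im w|`. [folklore] -/
private theorem norm_sub_le_re_im (z w : ℂ) : ‖z - w‖ ≤ |z.re - w.re| + |z.im - w.im| := by
  have h := Complex.norm_le_abs_re_add_abs_im (z - w)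
  rwa [Complex.sub_re, Complex.sub_im] at h

/-- **[6] (1.11)–(1.12) AT `A = 0`, COVARIANT-DERIVATIVE MEMBER, FOR THE TORUS CUBE PROPAGATORS AT EVERY PURE-GAUGE BACKGROUND** (the
`|(D^η_{A,μ}δG_k f)(x)|` clause of (1.10)·(1.12), p. 573; the p. 263 sentence *"Bounds analogous to (2.30), (2.31) hold for covariant derivatives …
of G_{k,loc}(u) of order less than two"*): there are `δ₀, c₀ > 0` depending on `(d, ℓ, a)` only such that, for all data as in `close112_flat_cube`
and every bond `⟨x, x+e_μ⟩` OF THE INNER CUBE (both end-points in `□`):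
`‖ε⁻¹(u_b(G_□f)(b₊) − (G_□f)(b₋)) − ε⁻¹(u_b(G_{Ω₀}f)(b₊) − (G_{Ω₀}f)(b₋))‖ ≤ c₀e^{−δ₀εD}e^{−δ₀ε(D_b+D_f)}F`, `u = 1^h`, `G_□ = G_k(□,1^h)`,
`G_{Ω₀} = G_k(Ω₀,1^h)` (r18's `covD`) — from r01/b04's `B4Delta112ZeroBox.delta112_zero_box_deriv` (the `η`-difference quotient member) on the
real and imaginary parts of `h̄f` read in the inner box, through gen 16's `covD_gBox_cube_pureGauge` on both cubes (`ε⁻¹·(L^kε)² = (L^kε)·L^k`,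
`L^kε ≤ 1`). [cite: Balaban1983RegularityDecay, (1.11)–(1.12) p.573] -/
theorem close112_flat_cube_deriv (d ℓ : ℕ) (hℓ : 1 ≤ ℓ) {a : ℝ} (ha : 0 < a) :
    ∃ δ₀ c₀ : ℝ, 0 < δ₀ ∧ 0 < c₀ ∧ ∀ (P : Params) (hPd : P.d = d + 1), P.L = ℓ + 1 →
      ∀ k : ℕ, 1 ≤ k → k ≤ P.K → ∀ (c M0 t M : Fin (d + 1) → ℕ), (∀ i, 1 ≤ M i) → (∀ i, t i + M i ≤ M0 i) →
        (∀ i, c i * P.L ^ k + P.L ^ k * M0 i ≤ P.sitesPerDir 0) → (∀ i, P.L ^ k * M0 i < P.sitesPerDir 0) →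
        ∀ (h : GaugeTransf P 0 U1) (x : Balaban1983to89.Site P 0) (μ : Fin P.d),
          x ∈ cubeT hPd (P.L ^ k) (c + t) (fun i => P.L ^ k * M i) → x.shift μ ∈ cubeT hPd (P.L ^ k) (c + t) (fun i => P.L ^ k * M i) →
        ∀ (f : Balaban1983to89.Site P 0 → ℂ) (F D Db Df : ℝ), (∀ y, ‖f y‖ ≤ F) →
          (∀ y, y ∉ cubeT hPd (P.L ^ k) (c + t) (fun i => P.L ^ k * M i) → f y = 0) →
          0 ≤ D → (∀ y, f y ≠ 0 → D ≤ B5Ineq137Torus.T P 0 x y) →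
          0 ≤ Db → (∀ w ∈ cubeT hPd (P.L ^ k) c (fun i => P.L ^ k * M0 i), w ∉ cubeT hPd (P.L ^ k) (c + t) (fun i => P.L ^ k * M i) →
            Db ≤ B5Ineq137Torus.T P 0 x w) →
          0 ≤ Df → (∀ y, f y ≠ 0 → ∀ w ∈ cubeT hPd (P.L ^ k) c (fun i => P.L ^ k * M0 i),
            w ∉ cubeT hPd (P.L ^ k) (c + t) (fun i => P.L ^ k * M i) → Df ≤ B5Ineq137Torus.T P 0 y w) →
          ‖covD P.eps⁻¹ (cfg (gaugeAct h (1 : GaugeField P 0 U1)))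
                (gBox (B1RG242Torus.α P a k * (P.L : ℝ) ^ (k * P.d)) P.eps⁻¹ (gaugeAct h (1 : GaugeField P 0 U1)) k
                  (cubeT hPd (P.L ^ k) (c + t) fun i => P.L ^ k * M i) *ᵥ f) ⟨x, μ⟩ -
            covD P.eps⁻¹ (cfg (gaugeAct h (1 : GaugeField P 0 U1)))
                (gBox (B1RG242Torus.α P a k * (P.L : ℝ) ^ (k * P.d)) P.eps⁻¹ (gaugeAct h (1 : GaugeField P 0 U1)) k
                  (cubeT hPd (P.L ^ k) c fun i => P.L ^ k * M0 i) *ᵥ f) ⟨x, μ⟩‖ ≤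
            c₀ * Real.exp (-(δ₀ * (P.eps * D))) * Real.exp (-(δ₀ * (P.eps * (Db + Df)))) * F := by
  obtain ⟨δ₀, c₀, hδ₀, hc₀, H⟩ := B4Delta112ZeroBox.delta112_zero_box_deriv d ℓ hℓ a a 0 ha
  refine ⟨δ₀, 2 * c₀, hδ₀, by positivity, ?_⟩
  intro P hPd hPL k hk1 hkK c M0 t M hM hnest hfit0 hN0 h x μ hx hxe f F D Db Df hF hfs hD hsD hDb hsDb hDf hsDf
  have hk : k ≤ P.m + P.K := hkK.trans (Nat.le_add_left _ _)
  have e1 : P.L ^ k = (ℓ + 1) ^ k := by rw [hPL]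
  rw [e1] at hfit0 hN0 hx hxe hfs hsDb hsDf ⊢
  have hn : (ℓ + 1) ^ k = P.L ^ k := e1.symm
  have hfit := fit_of_nested hnest hfit0
  have hN := short_of_nested hnest hN0
  have hM0 := one_le_of_nested hnest hM
  have hF0 : 0 ≤ F := (norm_nonneg _).trans (hF x)
  have hncast : (((ℓ + 1) ^ k : ℕ) : ℝ) = (P.L : ℝ) ^ k := by rw [hn]; push_cast; rfl
  have hnpos : (0 : ℝ) < (((ℓ + 1) ^ k : ℕ) : ℝ) := by positivity
  have hs1 : P.spacing k ≤ 1 := by rw [← P.spacing_K]; exact B4Ineq116Torus.spacing_le_spacing P hkK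
  have hexp : ∀ E : ℝ, 0 ≤ E → Real.exp (-(δ₀ * E / ((((ℓ + 1) ^ k : ℕ) : ℝ)))) ≤ Real.exp (-(δ₀ * (P.eps * E))) := fun E hE => by
    have h1 := exp_level_le_exp_eps P hkK hδ₀.le hE
    rwa [e1] at h1
  have hscale : P.eps⁻¹ * P.spacing k ^ 2 = P.spacing k * (((ℓ + 1) ^ k : ℕ) : ℝ) := by
    rw [hncast, Params.spacing]
    have hε : P.eps ≠ 0 := P.eps_pos.ne'
    field_simp
  have hLcast : ((ℓ : ℝ) + 1) = (P.L : ℝ) := by rw [hPL]; push_cast; ring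
  have H' := H k hk1 a 0 le_rfl le_rfl le_rfl le_rfl M M0 (fun i => (t i : ℤ)) (fits_of_nested hnest) hM
  rw [hLcast] at H'
  -- the two end-points of the bond in the inner box
  obtain ⟨z, hz, rfl⟩ := (mem_cubeT hPd).1 hx
  have hz0 := add_mem_boxDom_nested (n := (ℓ + 1) ^ k) hnest hz
  have hze : z + Pi.single (Fin.cast hPd μ) 1 ∈ boxDom (fun i => (ℓ + 1) ^ k * M i) := (shift_cubePt_mem_iff hPd hN hz μ).1 hxe
  have hshift : (cubePt hPd ((ℓ + 1) ^ k) (c + t) z).shift μ = cubePt hPd ((ℓ + 1) ^ k) (c + t) (z + Pi.single (Fin.cast hPd μ) 1) := by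
    rw [cubePt_add_single]
    congr 1
  -- the real estimate for a real source `φ` supported in the inner cube like `f`
  have key : ∀ φ : Balaban1983to89.Site P 0 → ℝ, (∀ y, |φ y| ≤ F) →
      (∀ y, y ∉ cubeT hPd ((ℓ + 1) ^ k) (c + t) (fun i => (ℓ + 1) ^ k * M i) → φ y = 0) →
      (∀ y, φ y ≠ 0 → D ≤ B5Ineq137Torus.T P 0 (cubePt hPd ((ℓ + 1) ^ k) (c + t) z) y) →
      (∀ y, φ y ≠ 0 → ∀ w ∈ cubeT hPd ((ℓ + 1) ^ k) c (fun i => (ℓ + 1) ^ k * M0 i),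
        w ∉ cubeT hPd ((ℓ + 1) ^ k) (c + t) (fun i => (ℓ + 1) ^ k * M i) → Df ≤ B5Ineq137Torus.T P 0 y w) →
      P.eps⁻¹ * |((gCubeR hPd ((ℓ + 1) ^ k) (c + t) M (P.spacing k ^ 2) (B1.aSeq a P.L k) *ᵥ φ)
              (cubePt hPd ((ℓ + 1) ^ k) (c + t) (z + Pi.single (Fin.cast hPd μ) 1)) -
            (gCubeR hPd ((ℓ + 1) ^ k) c M0 (P.spacing k ^ 2) (B1.aSeq a P.L k) *ᵥ φ)
              (cubePt hPd ((ℓ + 1) ^ k) (c + t) (z + Pi.single (Fin.cast hPd μ) 1))) -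
          ((gCubeR hPd ((ℓ + 1) ^ k) (c + t) M (P.spacing k ^ 2) (B1.aSeq a P.L k) *ᵥ φ) (cubePt hPd ((ℓ + 1) ^ k) (c + t) z) -
            (gCubeR hPd ((ℓ + 1) ^ k) c M0 (P.spacing k ^ 2) (B1.aSeq a P.L k) *ᵥ φ) (cubePt hPd ((ℓ + 1) ^ k) (c + t) z))| ≤
        c₀ * Real.exp (-(δ₀ * (P.eps * D))) * Real.exp (-(δ₀ * (P.eps * (Db + Df)))) * F := by
    intro φ hφ hφ0 hφD hφDf
    rw [gCubeR_sub_nested_cubePt hPd hfit0 hnest _ _ φ hφ0 hze, gCubeR_sub_nested_cubePt hPd hfit0 hnest _ _ φ hφ0 hz, ← mul_sub,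
      abs_mul, abs_of_nonneg (sq_nonneg _), ← mul_assoc, hscale, mul_assoc, ← abs_of_pos hnpos, ← abs_mul]
    have hB := H' (fun w => φ (cubePt hPd ((ℓ + 1) ^ k) (c + t) (w : Fin (d + 1) → ℤ))) F (fun w => hφ _) (Fin.cast hPd μ)
      ⟨z, hz⟩ ⟨z + Pi.single (Fin.cast hPd μ) 1, hze⟩ rfl D Db Df
      (fun w hw => (hφD _ hw).trans (T_cubePt_le hPd hfit hz w.2))
      (fun y' hy' => by
        have hw : cubePt hPd ((ℓ + 1) ^ k) c (y' : Fin (d + 1) → ℤ) ∈ cubeT hPd ((ℓ + 1) ^ k) c (fun i => (ℓ + 1) ^ k * M0 i) :=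
          cubePt_mem_cubeT hPd y'.2
        have hw' : cubePt hPd ((ℓ + 1) ^ k) c (y' : Fin (d + 1) → ℤ) ∉ cubeT hPd ((ℓ + 1) ^ k) (c + t) (fun i => (ℓ + 1) ^ k * M i) :=
          fun hm => hy' (sub_mem_of_cubePt_mem hPd hfit0 hnest y'.2 hm)
        have h1 := hsDb _ hw hw'
        rw [cubePt_nested hPd] at h1
        exact h1.trans (T_cubePt_le hPd hfit0 hz0 y'.2))
      (fun w hw y' hy' => by
        have hv : cubePt hPd ((ℓ + 1) ^ k) c (y' : Fin (d + 1) → ℤ) ∈ cubeT hPd ((ℓ + 1) ^ k) c (fun i => (ℓ + 1) ^ k * M0 i) :=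
          cubePt_mem_cubeT hPd y'.2
        have hv' : cubePt hPd ((ℓ + 1) ^ k) c (y' : Fin (d + 1) → ℤ) ∉ cubeT hPd ((ℓ + 1) ^ k) (c + t) (fun i => (ℓ + 1) ^ k * M i) :=
          fun hm => hy' (sub_mem_of_cubePt_mem hPd hfit0 hnest y'.2 hm)
        have h1 := hφDf _ hw _ hv hv'
        rw [cubePt_nested hPd] at h1
        exact h1.trans (T_cubePt_le hPd hfit0 (add_mem_boxDom_nested hnest w.2) y'.2))
    have hE : Real.exp (-(δ₀ * Db / ((((ℓ + 1) ^ k : ℕ) : ℝ)) + δ₀ * Df / ((((ℓ + 1) ^ k : ℕ) : ℝ)))) ≤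
        Real.exp (-(δ₀ * (P.eps * (Db + Df)))) := by
      have h1 := hexp Db hDb
      have h2 := hexp Df hDf
      have e2 : -(δ₀ * Db / ((((ℓ + 1) ^ k : ℕ) : ℝ)) + δ₀ * Df / ((((ℓ + 1) ^ k : ℕ) : ℝ))) =
          -(δ₀ * Db / ((((ℓ + 1) ^ k : ℕ) : ℝ))) + -(δ₀ * Df / ((((ℓ + 1) ^ k : ℕ) : ℝ))) := by ring
      have e3 : -(δ₀ * (P.eps * (Db + Df))) = -(δ₀ * (P.eps * Db)) + -(δ₀ * (P.eps * Df)) := by ring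
      rw [e2, e3, Real.exp_add, Real.exp_add]
      exact mul_le_mul h1 h2 (Real.exp_pos _).le (Real.exp_pos _).le
    calc P.spacing k * |((((ℓ + 1) ^ k : ℕ) : ℝ)) *
            (dG ((ℓ + 1) ^ k) (B1.aSeq a P.L k) 0 (fits_of_nested hnest)
                (fun w : ↥(boxDom fun i => (ℓ + 1) ^ k * M i) => φ (cubePt hPd ((ℓ + 1) ^ k) (c + t) (w : Fin (d + 1) → ℤ)))
                ⟨z + Pi.single (Fin.cast hPd μ) 1, hze⟩ -
              dG ((ℓ + 1) ^ k) (B1.aSeq a P.L k) 0 (fits_of_nested hnest)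
                (fun w : ↥(boxDom fun i => (ℓ + 1) ^ k * M i) => φ (cubePt hPd ((ℓ + 1) ^ k) (c + t) (w : Fin (d + 1) → ℤ))) ⟨z, hz⟩)|
        ≤ 1 * (c₀ * Real.exp (-(δ₀ * D / ((((ℓ + 1) ^ k : ℕ) : ℝ)))) *
            Real.exp (-(δ₀ * Db / ((((ℓ + 1) ^ k : ℕ) : ℝ)) + δ₀ * Df / ((((ℓ + 1) ^ k : ℕ) : ℝ)))) * F) :=
          mul_le_mul hs1 hB (abs_nonneg _) zero_le_one
      _ ≤ c₀ * Real.exp (-(δ₀ * (P.eps * D))) * Real.exp (-(δ₀ * (P.eps * (Db + Df)))) * F := by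
          rw [one_mul]
          refine mul_le_mul_of_nonneg_right ?_ hF0
          exact mul_le_mul (mul_le_mul_of_nonneg_left (hexp D hD) hc₀.le) hE (Real.exp_pos _).le (by positivity)
  -- pure gauge on both cubes, the bridge, and the real/imaginary split of `h̄f`
  rw [covD_gBox_cube_pureGauge hPd hk1 hk hn hfit hN hM ha, covD_gBox_cube_pureGauge hPd hk1 hk hn hfit0 hN0 hM0 ha, ← mul_sub, norm_mul,
    norm_toC, one_mul, ← mul_sub, norm_mul, Complex.norm_real, Real.norm_eq_abs, abs_of_pos (inv_pos.mpr P.eps_pos)]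
  set g : Balaban1983to89.Site P 0 → ℂ := fun y => (starRingEnd ℂ) (toC (h y)) * f y with hg
  have hgR : ∀ y, |(g y).re| ≤ F := fun y => ((Complex.abs_re_le_norm _).trans_eq (norm_rot h f y)).trans (hF y)
  have hgI : ∀ y, |(g y).im| ≤ F := fun y => ((Complex.abs_im_le_norm _).trans_eq (norm_rot h f y)).trans (hF y)
  have hg0 : ∀ y, f y = 0 → g y = 0 := fun y hf => by simp only [hg, hf, mul_zero]
  have hR0 : ∀ y, y ∉ cubeT hPd ((ℓ + 1) ^ k) (c + t) (fun i => (ℓ + 1) ^ k * M i) → (g y).re = 0 := fun y hy => by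
    rw [hg0 y (hfs y hy), Complex.zero_re]
  have hI0 : ∀ y, y ∉ cubeT hPd ((ℓ + 1) ^ k) (c + t) (fun i => (ℓ + 1) ^ k * M i) → (g y).im = 0 := fun y hy => by
    rw [hg0 y (hfs y hy), Complex.zero_im]
  have hRne : ∀ y, (g y).re ≠ 0 → f y ≠ 0 := fun y hy hf => hy (by rw [hg0 y hf, Complex.zero_re])
  have hIne : ∀ y, (g y).im ≠ 0 → f y ≠ 0 := fun y hy hf => hy (by rw [hg0 y hf, Complex.zero_im])
  have hE2 : 2 * c₀ * Real.exp (-(δ₀ * (P.eps * D))) * Real.exp (-(δ₀ * (P.eps * (Db + Df)))) * F =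
      c₀ * Real.exp (-(δ₀ * (P.eps * D))) * Real.exp (-(δ₀ * (P.eps * (Db + Df)))) * F +
        c₀ * Real.exp (-(δ₀ * (P.eps * D))) * Real.exp (-(δ₀ * (P.eps * (Db + Df)))) * F := by ring
  rw [hE2]
  have hsrc : (⟨cubePt hPd ((ℓ + 1) ^ k) (c + t) z, μ⟩ : PBond P 0).src = cubePt hPd ((ℓ + 1) ^ k) (c + t) z := rfl
  have htgt : (⟨cubePt hPd ((ℓ + 1) ^ k) (c + t) z, μ⟩ : PBond P 0).tgt =
      cubePt hPd ((ℓ + 1) ^ k) (c + t) (z + Pi.single (Fin.cast hPd μ) 1) := hshift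
  rw [hsrc, htgt]
  set As := (gCubeR hPd ((ℓ + 1) ^ k) (c + t) M (P.spacing k ^ 2) (B1.aSeq a P.L k)).map Complex.ofRealHom with hAs
  set Ab := (gCubeR hPd ((ℓ + 1) ^ k) c M0 (P.spacing k ^ 2) (B1.aSeq a P.L k)).map Complex.ofRealHom with hAb
  have hre : (As *ᵥ g) (cubePt hPd ((ℓ + 1) ^ k) (c + t) (z + Pi.single (Fin.cast hPd μ) 1)) - (As *ᵥ g) (cubePt hPd ((ℓ + 1) ^ k) (c + t) z) -
      ((Ab *ᵥ g) (cubePt hPd ((ℓ + 1) ^ k) (c + t) (z + Pi.single (Fin.cast hPd μ) 1)) - (Ab *ᵥ g) (cubePt hPd ((ℓ + 1) ^ k) (c + t) z)) =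
      ((As *ᵥ g) (cubePt hPd ((ℓ + 1) ^ k) (c + t) (z + Pi.single (Fin.cast hPd μ) 1)) -
          (Ab *ᵥ g) (cubePt hPd ((ℓ + 1) ^ k) (c + t) (z + Pi.single (Fin.cast hPd μ) 1))) -
        ((As *ᵥ g) (cubePt hPd ((ℓ + 1) ^ k) (c + t) z) - (Ab *ᵥ g) (cubePt hPd ((ℓ + 1) ^ k) (c + t) z)) := by ring
  rw [hre]
  refine (mul_le_mul_of_nonneg_left (norm_sub_le_re_im _ _) (inv_pos.mpr P.eps_pos).le).trans ?_
  rw [hAs, hAb, Complex.sub_re, Complex.sub_re, Complex.sub_im, Complex.sub_im, re_map_mulVec, re_map_mulVec, re_map_mulVec, re_map_mulVec,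
    im_map_mulVec, im_map_mulVec, im_map_mulVec, im_map_mulVec, mul_add]
  exact add_le_add
    (key _ hgR hR0 (fun y hy => hsD y (hRne y hy)) (fun y hy => hsDf y (hRne y hy)))
    (key _ hgI hI0 (fun y hy => hsD y (hIne y hy)) (fun y hy => hsDf y (hIne y hy)))

end Close112Deriv

/-! ## §5 (2.31) at flat backgrounds, KERNEL form: `G_{k,loc}(1^h)` against `G_k(Ω₀,1^h)` deep inside the box `Ω₀` -/

section Close231Kernel

/-- kernel: slower rates give larger exponentials, `e^{−δ′E} ≤ e^{−δE}` for `δ ≤ δ′`, `E ≥ 0`. [folklore] -/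
private theorem exp_le_exp_of_rate {δ δ' E : ℝ} (hδ : δ ≤ δ') (hE : 0 ≤ E) : Real.exp (-(δ' * E)) ≤ Real.exp (-(δ * E)) :=
  Real.exp_le_exp.2 (neg_le_neg (mul_le_mul_of_nonneg_right hδ hE))

/-- **The algebra of the bracketed sentence of p. 263** (*"Each G_k(□_α,u) is close to G_k(Ω,u) for the relevant x₁, x₂, therefore the convex
combination and G_{k,loc} are close also"*), entrywise, for gen 15's torus `G_{k,loc}` and ANY comparison kernel `G₀`: when the weights are
complete at `(x,y)` wherever the cut-off does not vanish (`ζ″(x,y) ≠ 0 ⟹ Σ_αλ_α(x,y) = 1`),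
`G_{k,loc}(u;x,y) − G₀(x,y) = ζ″(x,y)·Σ_αλ_α(x,y)(G_k(□_α,u;x,y) − G₀(x,y)) + (ζ″(x,y) − 1)·G₀(x,y)` (p02's `abs_loc_sub_le` split, as an
identity, complex entries). [cite: BalabanImbrieJaffe1988, (2.31) p.263] -/
theorem gLocT_sub_eq {j : ℕ} (a' c' : ℝ) (U : GaugeField P j U1) (k : ℕ) {ι : Type*} [Fintype ι]
    (cube : ι → Finset (Balaban1983to89.Site P j)) (lam : ι → Balaban1983to89.Site P j → Balaban1983to89.Site P j → ℝ)
    (ζ'' : Balaban1983to89.Site P j → Balaban1983to89.Site P j → ℝ) (G₀ : Matrix (Balaban1983to89.Site P j) (Balaban1983to89.Site P j) ℂ)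
    {x y : Balaban1983to89.Site P j} (hcomp : ζ'' x y ≠ 0 → ∑ α, lam α x y = 1) :
    gLocT a' c' U k cube lam ζ'' x y - G₀ x y =
      (ζ'' x y : ℂ) * ∑ α, (lam α x y : ℂ) * (gBox a' c' U k (cube α) x y - G₀ x y) + ((ζ'' x y : ℂ) - 1) * G₀ x y := by
  rw [gLocT_apply, gTilde_apply]
  by_cases hz : ζ'' x y = 0
  · rw [hz]; push_cast; ring
  · have hs : ∑ α, (lam α x y : ℂ) = 1 := by
      have h1 := hcomp hz
      exact_mod_cast h1
    simp only [mul_sub, Finset.sum_sub_distrib, ← Finset.sum_mul, hs, one_mul]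
    ring

/-- **(2.31) AT EVERY PURE-GAUGE BACKGROUND, KERNEL FORM** (*"|(G_{k,loc}(u)f − G_k(Ω,u)f)(x)| ≤ e^{−cr(e_k)}e^{−c dist(suppt f,x)}‖f‖_∞, (2.31)
for dist(x,Ω^c) ≥ O(r(e_k)). [Each G_k(□_α,u) is close to G_k(Ω,u) for the relevant x₁, x₂, therefore the convex combination and G_{k,loc}
are close also.]"*, p. 263): there are `δ₀, c₀ > 0` depending on `(d, ℓ, a)` only such that, on every torus of the series with `d + 1`
directions and `L = ℓ + 1`, for every level `1 ≤ k ≤ K`, every box `Ω₀ = c·L^k + Π_i[0, L^kM₀_i)` that fits and is shorter than the torus,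
every finite family of cubes `□_α = (c+t_α)·L^k + Π_i[0, L^kM_{α,i})` NESTED IN `Ω₀`, all real weights with `Σ_α|λ_α| ≤ 1` and cut-off
`0 ≤ ζ″ ≤ 1` (gen 15's DATA of `gLocT`), every gauge function `h`, every site `x` and radii `R, R₁ ≥ 0` such that ON THE ROW OF `x`:
(i) the weights are complete where the cut-off lives (`ζ″(x,y) ≠ 0 ⟹ Σ_αλ_α(x,y) = 1`), (ii) every cube ACTIVE at `(x,y)`
(`ζ″(x,y)λ_α(x,y) ≠ 0`) contains `x` and `y` at sup-torus distance `≥ R` from `Ω₀∖□_α` (*"The boundary conditions are always at a distance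
O(r(e_k)) from x₁, x₂"*), (iii) `ζ″(x,y) = 1` for `|x−y|_T ≤ R₁` ((2.29)): for every `y`,
`‖G_{k,loc}(1^h;x,y) − G_k(Ω₀,1^h;x,y)‖ ≤ c₀(e^{−2δ₀εR} + e^{−(δ₀/2)εR₁})·e^{−(δ₀/2)ε|x−y|_T}` — §3's (1.11)–(1.12) kernel for the active cubes,
gen 16's (1.10) kernel `decay110_flat_cube_kernel` for the tail of `G_k(Ω₀,1^h)` beyond `R₁`. [cite: BalabanImbrieJaffe1988, (2.31) p.263] -/
theorem close231_flat_kernel (d ℓ : ℕ) (hℓ : 1 ≤ ℓ) {a : ℝ} (ha : 0 < a) :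
    ∃ δ₀ c₀ : ℝ, 0 < δ₀ ∧ 0 < c₀ ∧ ∀ (P : Params) (hPd : P.d = d + 1), P.L = ℓ + 1 →
      ∀ k : ℕ, 1 ≤ k → k ≤ P.K → ∀ (c M0 : Fin (d + 1) → ℕ), (∀ i, 1 ≤ M0 i) →
        (∀ i, c i * P.L ^ k + P.L ^ k * M0 i ≤ P.sitesPerDir 0) → (∀ i, P.L ^ k * M0 i < P.sitesPerDir 0) →
      ∀ (ι : Type) [Fintype ι] (cube : ι → Finset (Balaban1983to89.Site P 0))
        (lam : ι → Balaban1983to89.Site P 0 → Balaban1983to89.Site P 0 → ℝ)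
        (ζ'' : Balaban1983to89.Site P 0 → Balaban1983to89.Site P 0 → ℝ),
        (∀ α, ∃ t M : Fin (d + 1) → ℕ, (∀ i, 1 ≤ M i) ∧ (∀ i, t i + M i ≤ M0 i) ∧
            cube α = cubeT hPd (P.L ^ k) (c + t) fun i => P.L ^ k * M i) →
        (∀ x y, ∑ α, |lam α x y| ≤ 1) → (∀ x y, 0 ≤ ζ'' x y ∧ ζ'' x y ≤ 1) →
      ∀ (h : GaugeTransf P 0 U1) (x : Balaban1983to89.Site P 0) (R R₁ : ℝ), 0 ≤ R → 0 ≤ R₁ →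
        (∀ y, ζ'' x y ≠ 0 → ∑ α, lam α x y = 1) →
        (∀ α y, ζ'' x y * lam α x y ≠ 0 → x ∈ cube α ∧ y ∈ cube α ∧
            ∀ w ∈ cubeT hPd (P.L ^ k) c (fun i => P.L ^ k * M0 i), w ∉ cube α →
              R ≤ B5Ineq137Torus.T P 0 x w ∧ R ≤ B5Ineq137Torus.T P 0 y w) →
        (∀ y, B5Ineq137Torus.T P 0 x y ≤ R₁ → ζ'' x y = 1) →
      ∀ y : Balaban1983to89.Site P 0,
        ‖gLocT (B1RG242Torus.α P a k * (P.L : ℝ) ^ (k * P.d)) P.eps⁻¹ (gaugeAct h (1 : GaugeField P 0 U1)) k cube lam ζ'' x y -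
            gBox (B1RG242Torus.α P a k * (P.L : ℝ) ^ (k * P.d)) P.eps⁻¹ (gaugeAct h (1 : GaugeField P 0 U1)) k
              (cubeT hPd (P.L ^ k) c fun i => P.L ^ k * M0 i) x y‖ ≤
          c₀ * (Real.exp (-(δ₀ * (P.eps * (2 * R)))) + Real.exp (-(δ₀ / 2 * (P.eps * R₁)))) *
            Real.exp (-(δ₀ / 2 * (P.eps * B5Ineq137Torus.T P 0 x y))) := by
  obtain ⟨δ₁, c₁, hδ₁, hc₁, H1⟩ := close112_flat_cube_kernel d ℓ hℓ ha
  obtain ⟨δ₂, c₂, hδ₂, hc₂, H2⟩ := decay110_flat_cube_kernel d ℓ hℓ ha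
  refine ⟨min δ₁ δ₂, max c₁ c₂, lt_min hδ₁ hδ₂, lt_max_of_lt_left hc₁, ?_⟩
  intro P hPd hPL k hk1 hkK c M0 hM0 hfit0 hN0 ι _ cube lam ζ hcube hlam hζ h x R R₁ hR hR₁ hcomp hdeep hcut y
  set δ := min δ₁ δ₂ with hδdef
  set C := max c₁ c₂ with hCdef
  have hδ1 : δ ≤ δ₁ := min_le_left _ _
  have hδ2 : δ ≤ δ₂ := min_le_right _ _
  have hδ0 : 0 ≤ δ := (lt_min hδ₁ hδ₂).le
  have hC1 : c₁ ≤ C := le_max_left _ _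
  have hC2 : c₂ ≤ C := le_max_right _ _
  have hC0 : 0 ≤ C := hc₁.le.trans hC1
  have hε : 0 < P.eps := P.eps_pos
  set Txy := B5Ineq137Torus.T P 0 x y with hTdef
  have hT0 : 0 ≤ Txy := B5Ineq137Torus.T_nonneg P 0 x y
  set G0 := gBox (B1RG242Torus.α P a k * (P.L : ℝ) ^ (k * P.d)) P.eps⁻¹ (gaugeAct h (1 : GaugeField P 0 U1)) k
    (cubeT hPd (P.L ^ k) c fun i => P.L ^ k * M0 i) with hG0def
  -- the entry of the outer box propagator ((1.10), gen 16)
  have hG0 : ‖G0 x y‖ ≤ c₂ * Real.exp (-(δ₂ * (P.eps * Txy))) := H2 P hPd hPL k hk1 hkK c M0 hM0 hfit0 hN0 h x y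
  -- the active cubes are close to the outer box at (x,y) ((1.11)–(1.12), §3)
  have hGa : ∀ α, ζ x y * lam α x y ≠ 0 →
      ‖gBox (B1RG242Torus.α P a k * (P.L : ℝ) ^ (k * P.d)) P.eps⁻¹ (gaugeAct h (1 : GaugeField P 0 U1)) k (cube α) x y - G0 x y‖ ≤
        c₁ * Real.exp (-(δ₁ * (P.eps * Txy))) * Real.exp (-(δ₁ * (P.eps * (R + R)))) := by
    intro α hα
    obtain ⟨hxα, hyα, hw⟩ := hdeep α y hα
    obtain ⟨t, M, hM, hnest, hc⟩ := hcube α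
    rw [hc] at hxα hyα hw
    rw [hc]
    exact H1 P hPd hPL k hk1 hkK c M0 t M hM hnest hfit0 hN0 h x y hxα hyα R R hR hR hw
  rw [gLocT_sub_eq _ _ _ _ cube lam ζ G0 (hcomp y)]
  -- term 1: the convex combination of the differences
  set B := c₁ * Real.exp (-(δ₁ * (P.eps * Txy))) * Real.exp (-(δ₁ * (P.eps * (R + R)))) with hBdef
  have hB0 : 0 ≤ B := by positivity
  have h1 : ‖(ζ x y : ℂ) * ∑ α, (lam α x y : ℂ) *
      (gBox (B1RG242Torus.α P a k * (P.L : ℝ) ^ (k * P.d)) P.eps⁻¹ (gaugeAct h (1 : GaugeField P 0 U1)) k (cube α) x y - G0 x y)‖ ≤ B := by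
    have hz1 : |ζ x y| ≤ 1 := abs_le.2 ⟨by linarith [(hζ x y).1], (hζ x y).2⟩
    calc ‖(ζ x y : ℂ) * ∑ α, (lam α x y : ℂ) *
          (gBox (B1RG242Torus.α P a k * (P.L : ℝ) ^ (k * P.d)) P.eps⁻¹ (gaugeAct h (1 : GaugeField P 0 U1)) k (cube α) x y - G0 x y)‖
        ≤ |ζ x y| * ∑ α, |lam α x y| *
          ‖gBox (B1RG242Torus.α P a k * (P.L : ℝ) ^ (k * P.d)) P.eps⁻¹ (gaugeAct h (1 : GaugeField P 0 U1)) k (cube α) x y - G0 x y‖ := by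
            rw [norm_mul, Complex.norm_real, Real.norm_eq_abs]
            refine mul_le_mul_of_nonneg_left ((norm_sum_le _ _).trans (Finset.sum_le_sum fun α _ => ?_)) (abs_nonneg _)
            rw [norm_mul, Complex.norm_real, Real.norm_eq_abs]
      _ = ∑ α, |ζ x y * lam α x y| *
          ‖gBox (B1RG242Torus.α P a k * (P.L : ℝ) ^ (k * P.d)) P.eps⁻¹ (gaugeAct h (1 : GaugeField P 0 U1)) k (cube α) x y - G0 x y‖ := by
            rw [Finset.mul_sum]
            exact Finset.sum_congr rfl fun α _ => by rw [abs_mul, mul_assoc]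
      _ ≤ ∑ α, |ζ x y * lam α x y| * B := Finset.sum_le_sum fun α _ => by
            by_cases hα : ζ x y * lam α x y = 0
            · rw [hα, abs_zero, zero_mul, zero_mul]
            · exact mul_le_mul_of_nonneg_left (hGa α hα) (abs_nonneg _)
      _ = |ζ x y| * (∑ α, |lam α x y|) * B := by
            rw [Finset.mul_sum, Finset.sum_mul]
            exact Finset.sum_congr rfl fun α _ => by rw [abs_mul]
      _ ≤ 1 * 1 * B := mul_le_mul_of_nonneg_right
            (mul_le_mul hz1 (hlam x y) (Finset.sum_nonneg fun α _ => abs_nonneg _) zero_le_one) hB0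
      _ = B := by ring
  -- term 2: the tail of the outer propagator beyond `R₁`
  have h2 : ‖((ζ x y : ℂ) - 1) * G0 x y‖ ≤ c₂ * Real.exp (-(δ₂ / 2 * (P.eps * R₁))) * Real.exp (-(δ₂ / 2 * (P.eps * Txy))) := by
    by_cases hT1 : Txy ≤ R₁
    · rw [hcut y hT1]
      push_cast
      rw [sub_self, zero_mul, norm_zero]
      positivity
    · rw [not_le] at hT1
      have hz1 : ‖(ζ x y : ℂ) - 1‖ ≤ 1 := by
        rw [← Complex.ofReal_one, ← Complex.ofReal_sub, Complex.norm_real, Real.norm_eq_abs, abs_le]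
        constructor <;> linarith [(hζ x y).1, (hζ x y).2]
      calc ‖((ζ x y : ℂ) - 1) * G0 x y‖ = ‖(ζ x y : ℂ) - 1‖ * ‖G0 x y‖ := norm_mul _ _
        _ ≤ 1 * (c₂ * Real.exp (-(δ₂ * (P.eps * Txy)))) := mul_le_mul hz1 hG0 (norm_nonneg _) zero_le_one
        _ ≤ c₂ * Real.exp (-(δ₂ / 2 * (P.eps * R₁))) * Real.exp (-(δ₂ / 2 * (P.eps * Txy))) := by
            rw [one_mul, mul_assoc, ← Real.exp_add]
            refine mul_le_mul_of_nonneg_left (Real.exp_le_exp.2 ?_) hc₂.le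
            have : P.eps * R₁ ≤ P.eps * Txy := mul_le_mul_of_nonneg_left hT1.le hε.le
            nlinarith
  -- assemble with the common rate `δ = min δ₁ δ₂` and constant `C = max c₁ c₂`
  have hεT : 0 ≤ P.eps * Txy := mul_nonneg hε.le hT0
  have h1' : B ≤ C * Real.exp (-(δ * (P.eps * (2 * R)))) * Real.exp (-(δ / 2 * (P.eps * Txy))) := by
    rw [hBdef, mul_assoc, mul_assoc, mul_comm (Real.exp _) (Real.exp _)]
    refine mul_le_mul hC1 (mul_le_mul ?_ ?_ (Real.exp_pos _).le (Real.exp_pos _).le) (by positivity) hC0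
    · rw [show R + R = 2 * R by ring]
      exact exp_le_exp_of_rate hδ1 (by positivity)
    · exact exp_le_exp_of_rate (by linarith) hεT
  have h2' : c₂ * Real.exp (-(δ₂ / 2 * (P.eps * R₁))) * Real.exp (-(δ₂ / 2 * (P.eps * Txy))) ≤
      C * Real.exp (-(δ / 2 * (P.eps * R₁))) * Real.exp (-(δ / 2 * (P.eps * Txy))) :=
    mul_le_mul (mul_le_mul hC2 (exp_le_exp_of_rate (by linarith) (by positivity)) (Real.exp_pos _).le hC0)
      (exp_le_exp_of_rate (by linarith) hεT) (Real.exp_pos _).le (by positivity)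
  calc ‖(ζ x y : ℂ) * ∑ α, (lam α x y : ℂ) *
          (gBox (B1RG242Torus.α P a k * (P.L : ℝ) ^ (k * P.d)) P.eps⁻¹ (gaugeAct h (1 : GaugeField P 0 U1)) k (cube α) x y - G0 x y) +
        ((ζ x y : ℂ) - 1) * G0 x y‖
      ≤ B + c₂ * Real.exp (-(δ₂ / 2 * (P.eps * R₁))) * Real.exp (-(δ₂ / 2 * (P.eps * Txy))) := (norm_add_le _ _).trans (add_le_add h1 h2)
    _ ≤ C * Real.exp (-(δ * (P.eps * (2 * R)))) * Real.exp (-(δ / 2 * (P.eps * Txy))) +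
        C * Real.exp (-(δ / 2 * (P.eps * R₁))) * Real.exp (-(δ / 2 * (P.eps * Txy))) := add_le_add h1' h2'
    _ = C * (Real.exp (-(δ * (P.eps * (2 * R)))) + Real.exp (-(δ / 2 * (P.eps * R₁)))) * Real.exp (-(δ / 2 * (P.eps * Txy))) := by
        ring

end Close231Kernel

/-! ## §6 (2.30) and (2.31) at flat backgrounds in OPERATOR form, with the active cubes of the row of `x` («at most 2^d terms») -/

section Operator

/-- **`G_{k,loc}(u)f` cube by cube**: `(G_{k,loc}(u)f)(x) = Σ_α (G_k(□_α,u)g_α)(x)` with the row-`x` sources `g_α(y) = ζ″(x,y)λ_α(x,y)f(y)`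
(any background `u`, any level; the weights depend on `(x₁ + x₂)/2` and do not factor out of the sum over `y` otherwise).
[cite: BalabanImbrieJaffe1988, (2.28) p.263] -/
theorem gLocT_mulVec_apply {j : ℕ} (a' c' : ℝ) (U : GaugeField P j U1) (k : ℕ) {ι : Type*} [Fintype ι]
    (cube : ι → Finset (Balaban1983to89.Site P j)) (lam : ι → Balaban1983to89.Site P j → Balaban1983to89.Site P j → ℝ)
    (ζ'' : Balaban1983to89.Site P j → Balaban1983to89.Site P j → ℝ) (f : Balaban1983to89.Site P j → ℂ) (x : Balaban1983to89.Site P j) :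
    (gLocT a' c' U k cube lam ζ'' *ᵥ f) x = ∑ α, (gBox a' c' U k (cube α) *ᵥ fun y => (ζ'' x y : ℂ) * (lam α x y : ℂ) * f y) x := by
  simp only [mulVec, dotProduct, gLocT_apply, gTilde_apply, Finset.mul_sum, Finset.sum_mul]
  rw [Finset.sum_comm]
  exact Finset.sum_congr rfl fun α _ => Finset.sum_congr rfl fun y _ => by ring

/-- **`G_{k,loc}(u)f − G₀f` cube by cube** under completeness of the weights on the row of `x`:
`(G_{k,loc}(u)f − G₀f)(x) = Σ_α ((G_k(□_α,u) − G₀)g_α)(x) + (G₀g′)(x)`, `g_α(y) = ζ″(x,y)λ_α(x,y)f(y)`, `g′(y) = (ζ″(x,y) − 1)f(y)`.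
[cite: BalabanImbrieJaffe1988, (2.31) p.263] -/
theorem gLocT_sub_mulVec_apply {j : ℕ} (a' c' : ℝ) (U : GaugeField P j U1) (k : ℕ) {ι : Type*} [Fintype ι]
    (cube : ι → Finset (Balaban1983to89.Site P j)) (lam : ι → Balaban1983to89.Site P j → Balaban1983to89.Site P j → ℝ)
    (ζ'' : Balaban1983to89.Site P j → Balaban1983to89.Site P j → ℝ) (G₀ : Matrix (Balaban1983to89.Site P j) (Balaban1983to89.Site P j) ℂ)
    (f : Balaban1983to89.Site P j → ℂ) (x : Balaban1983to89.Site P j) (hcomp : ∀ y, ζ'' x y ≠ 0 → ∑ α, lam α x y = 1) :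
    (gLocT a' c' U k cube lam ζ'' *ᵥ f) x - (G₀ *ᵥ f) x =
      ∑ α, ((gBox a' c' U k (cube α) - G₀) *ᵥ fun y => (ζ'' x y : ℂ) * (lam α x y : ℂ) * f y) x +
        (G₀ *ᵥ fun y => ((ζ'' x y : ℂ) - 1) * f y) x := by
  have hpt : ∀ y, gLocT a' c' U k cube lam ζ'' x y * f y - G₀ x y * f y =
      (∑ α, (gBox a' c' U k (cube α) x y - G₀ x y) * ((ζ'' x y : ℂ) * (lam α x y : ℂ) * f y)) + G₀ x y * (((ζ'' x y : ℂ) - 1) * f y) := by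
    intro y
    rw [← sub_mul, gLocT_sub_eq a' c' U k cube lam ζ'' G₀ (hcomp y), add_mul, Finset.mul_sum, Finset.sum_mul]
    congr 1
    · exact Finset.sum_congr rfl fun α _ => by ring
    · ring
  simp only [mulVec, dotProduct, Matrix.sub_apply]
  rw [← Finset.sum_sub_distrib, Finset.sum_comm, ← Finset.sum_add_distrib]
  exact Finset.sum_congr rfl fun y _ => hpt y

/-- kernel: a single weight is at most the `ℓ¹` mass of the row: `|λ_α(x,y)| ≤ Σ_β|λ_β(x,y)| ≤ 1`. [cite: BalabanImbrieJaffe1988, (2.27) p.263] -/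
theorem abs_lam_le_one {ι : Type*} [Fintype ι] {β : Type*} {lam : ι → β → β → ℝ} (hlam : ∀ x y, ∑ α, |lam α x y| ≤ 1) (α : ι) (x y : β) :
    |lam α x y| ≤ 1 :=
  (Finset.single_le_sum (fun β _ => abs_nonneg (lam β x y)) (Finset.mem_univ α)).trans (hlam x y)

/-- kernel: the row-`x` source `g_α(y) = ζ″(x,y)λ_α(x,y)f(y)` is bounded by `‖f‖_∞` (`|ζ″| ≤ 1`, `|λ_α| ≤ 1`). [cite: BalabanImbrieJaffe1988, (2.28) p.263] -/
theorem norm_rowSource_le {β : Type*} {ζ l : ℝ} (hζ : |ζ| ≤ 1) (hl : |l| ≤ 1) {f : β → ℂ} {F : ℝ} (hF : ∀ y, ‖f y‖ ≤ F) (y : β) :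
    ‖(ζ : ℂ) * (l : ℂ) * f y‖ ≤ F := by
  rw [norm_mul, norm_mul, Complex.norm_real, Complex.norm_real, Real.norm_eq_abs, Real.norm_eq_abs]
  calc |ζ| * |l| * ‖f y‖ ≤ 1 * 1 * F := mul_le_mul (mul_le_mul hζ hl (abs_nonneg _) zero_le_one) (hF y) (norm_nonneg _) (by norm_num)
    _ = F := by ring

/-- kernel: where the row-`x` source `g_α` does not vanish, the cube is active and `f ≠ 0`. [cite: BalabanImbrieJaffe1988, (2.28) p.263] -/
theorem rowSource_ne_zero {β : Type*} {ζ l : ℝ} {f : β → ℂ} {y : β} (h : (ζ : ℂ) * (l : ℂ) * f y ≠ 0) : ζ * l ≠ 0 ∧ f y ≠ 0 :=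
  ⟨fun h0 => h (by rw [← Complex.ofReal_mul, h0, Complex.ofReal_zero, zero_mul]), fun hf => h (by rw [hf, mul_zero])⟩

/-- **(2.30) AT EVERY PURE-GAUGE BACKGROUND, OPERATOR FORM** (*"|(G_{k,loc}(u)f)(x)| ≤ ce^{−c dist(suppt f,x)}‖f‖_∞ (2.30)"*; *"The convex
combination … involves at most 2^d terms"*, p. 263): there are `δ₀, c₀ > 0` depending on `(d, ℓ, a)` only such that, for gen 15's torus
`G_{k,loc}` over ANY finite family of no-wrap cubes shorter than the torus, real weights `Σ_α|λ_α| ≤ 1`, cut-off `|ζ″| ≤ 1`, every gauge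
function `h`, every `x`, every complex source `f` with `‖f‖_∞ ≤ F` at sup-torus distance `≥ D ≥ 0` from `x`, and every finite set `S` of cube
labels containing the cubes ACTIVE on the row of `x` against `f` (`ζ″(x,y)λ_α(x,y) ≠ 0`, `f(y) ≠ 0 ⟹ α ∈ S`):
`‖(G_{k,loc}(1^h)f)(x)‖ ≤ #S·c₀e^{−δ₀εD}F` — cube by cube from gen 16's `decay110_flat_cube` on the row sources `g_α = ζ″λ_αf`; the constant is
uniform in `k` and the volume (no row sum). [cite: BalabanImbrieJaffe1988, (2.30) p.263] -/
theorem opDecay230_flat (d ℓ : ℕ) (hℓ : 1 ≤ ℓ) {a : ℝ} (ha : 0 < a) :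
    ∃ δ₀ c₀ : ℝ, 0 < δ₀ ∧ 0 < c₀ ∧ ∀ (P : Params) (hPd : P.d = d + 1), P.L = ℓ + 1 →
      ∀ k : ℕ, 1 ≤ k → k ≤ P.K → ∀ (ι : Type) [Fintype ι] (cube : ι → Finset (Balaban1983to89.Site P 0))
        (lam : ι → Balaban1983to89.Site P 0 → Balaban1983to89.Site P 0 → ℝ)
        (ζ'' : Balaban1983to89.Site P 0 → Balaban1983to89.Site P 0 → ℝ),
        (∀ α, ∃ c M : Fin (d + 1) → ℕ, (∀ i, 1 ≤ M i) ∧ (∀ i, c i * P.L ^ k + P.L ^ k * M i ≤ P.sitesPerDir 0) ∧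
            (∀ i, P.L ^ k * M i < P.sitesPerDir 0) ∧ cube α = cubeT hPd (P.L ^ k) c fun i => P.L ^ k * M i) →
        (∀ x y, ∑ α, |lam α x y| ≤ 1) → (∀ x y, |ζ'' x y| ≤ 1) →
      ∀ (h : GaugeTransf P 0 U1) (x : Balaban1983to89.Site P 0) (f : Balaban1983to89.Site P 0 → ℂ) (F D : ℝ),
        (∀ y, ‖f y‖ ≤ F) → 0 ≤ D → (∀ y, f y ≠ 0 → D ≤ B5Ineq137Torus.T P 0 x y) →
      ∀ S : Finset ι, (∀ α y, ζ'' x y * lam α x y ≠ 0 → f y ≠ 0 → α ∈ S) →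
        ‖(gLocT (B1RG242Torus.α P a k * (P.L : ℝ) ^ (k * P.d)) P.eps⁻¹ (gaugeAct h (1 : GaugeField P 0 U1)) k cube lam ζ'' *ᵥ f) x‖ ≤
          S.card * (c₀ * Real.exp (-(δ₀ * (P.eps * D))) * F) := by
  obtain ⟨δ₀, c₀, hδ₀, hc₀, H⟩ := decay110_flat_cube d ℓ hℓ ha
  refine ⟨δ₀, c₀, hδ₀, hc₀, ?_⟩
  intro P hPd hPL k hk1 hkK ι _ cube lam ζ hcube hlam hζ h x f F D hF hD hsupp S hS
  rw [gLocT_mulVec_apply]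
  have hterm : ∀ α, ‖(gBox (B1RG242Torus.α P a k * (P.L : ℝ) ^ (k * P.d)) P.eps⁻¹ (gaugeAct h (1 : GaugeField P 0 U1)) k (cube α) *ᵥ
      fun y => (ζ x y : ℂ) * (lam α x y : ℂ) * f y) x‖ ≤ c₀ * Real.exp (-(δ₀ * (P.eps * D))) * F := by
    intro α
    obtain ⟨c', M, hM, hfit, hN, hc⟩ := hcube α
    rw [hc]
    exact H P hPd hPL k hk1 hkK c' M hM hfit hN h x _ F D (fun y => norm_rowSource_le (hζ x y) (abs_lam_le_one hlam α x y) hF y) hD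
      (fun y hy => hsupp y (rowSource_ne_zero hy).2)
  have hzero : ∀ α, α ∉ S → (gBox (B1RG242Torus.α P a k * (P.L : ℝ) ^ (k * P.d)) P.eps⁻¹ (gaugeAct h (1 : GaugeField P 0 U1)) k (cube α) *ᵥ
      fun y => (ζ x y : ℂ) * (lam α x y : ℂ) * f y) x = 0 := by
    intro α hα
    have h0 : (fun y => (ζ x y : ℂ) * (lam α x y : ℂ) * f y) = 0 := by
      funext y
      by_contra hne
      exact hα (hS α y (rowSource_ne_zero hne).1 (rowSource_ne_zero hne).2)
    rw [h0, mulVec_zero, Pi.zero_apply]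
  rw [← Finset.sum_subset (Finset.subset_univ S) (fun α _ hα => hzero α hα)]
  calc ‖∑ α ∈ S, (gBox (B1RG242Torus.α P a k * (P.L : ℝ) ^ (k * P.d)) P.eps⁻¹ (gaugeAct h (1 : GaugeField P 0 U1)) k (cube α) *ᵥ
          fun y => (ζ x y : ℂ) * (lam α x y : ℂ) * f y) x‖
      ≤ ∑ α ∈ S, ‖(gBox (B1RG242Torus.α P a k * (P.L : ℝ) ^ (k * P.d)) P.eps⁻¹ (gaugeAct h (1 : GaugeField P 0 U1)) k (cube α) *ᵥ
          fun y => (ζ x y : ℂ) * (lam α x y : ℂ) * f y) x‖ := norm_sum_le _ _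
    _ ≤ ∑ α ∈ S, c₀ * Real.exp (-(δ₀ * (P.eps * D))) * F := Finset.sum_le_sum fun α _ => hterm α
    _ = S.card * (c₀ * Real.exp (-(δ₀ * (P.eps * D))) * F) := by rw [Finset.sum_const, nsmul_eq_mul]

/-- **(2.31) AT EVERY PURE-GAUGE BACKGROUND, OPERATOR FORM** (*"|(G_{k,loc}(u)f − G_k(Ω,u)f)(x)| ≤ e^{−cr(e_k)}e^{−c dist(suppt f,x)}‖f‖_∞,
(2.31) for dist(x,Ω^c) ≥ O(r(e_k))"*, p. 263): there are `δ₀, c₀ > 0` depending on `(d, ℓ, a)` only such that, for every box `Ω₀` that fits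
and is shorter than the torus, gen 15's torus `G_{k,loc}` over any finite family of cubes NESTED IN `Ω₀`, real weights `Σ_α|λ_α| ≤ 1`,
cut-off `0 ≤ ζ″ ≤ 1`, every gauge function `h`, every `x` and radii `R, R₁ ≥ 0` with (i) completeness of the weights on the row of `x` where
`ζ″(x,·) ≠ 0`, (ii) every cube active at `(x,y)` containing `x`, `y` at sup-torus distance `≥ R` from `Ω₀∖□_α`, (iii) `ζ″(x,y) = 1` for
`|x−y|_T ≤ R₁`, every complex source `f` with `‖f‖_∞ ≤ F` at sup-torus distance `≥ D ≥ 0` from `x`, and every finite set `S` of labels containing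
the cubes active on the row of `x` against `f`:
`‖(G_{k,loc}(1^h)f)(x) − (G_k(Ω₀,1^h)f)(x)‖ ≤ c₀(#S·e^{−2δ₀εR} + e^{−(δ₀/2)εR₁})e^{−(δ₀/2)εD}F` — §3's (1.11)–(1.12) operator form on the row
sources `g_α` of the active cubes, gen 16's (1.10) `decay110_flat_cube` on the tail source `(ζ″ − 1)f` supported beyond `R₁`.
[cite: BalabanImbrieJaffe1988, (2.31) p.263] -/
theorem opClose231_flat (d ℓ : ℕ) (hℓ : 1 ≤ ℓ) {a : ℝ} (ha : 0 < a) :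
    ∃ δ₀ c₀ : ℝ, 0 < δ₀ ∧ 0 < c₀ ∧ ∀ (P : Params) (hPd : P.d = d + 1), P.L = ℓ + 1 →
      ∀ k : ℕ, 1 ≤ k → k ≤ P.K → ∀ (c M0 : Fin (d + 1) → ℕ), (∀ i, 1 ≤ M0 i) →
        (∀ i, c i * P.L ^ k + P.L ^ k * M0 i ≤ P.sitesPerDir 0) → (∀ i, P.L ^ k * M0 i < P.sitesPerDir 0) →
      ∀ (ι : Type) [Fintype ι] (cube : ι → Finset (Balaban1983to89.Site P 0))
        (lam : ι → Balaban1983to89.Site P 0 → Balaban1983to89.Site P 0 → ℝ)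
        (ζ'' : Balaban1983to89.Site P 0 → Balaban1983to89.Site P 0 → ℝ),
        (∀ α, ∃ t M : Fin (d + 1) → ℕ, (∀ i, 1 ≤ M i) ∧ (∀ i, t i + M i ≤ M0 i) ∧
            cube α = cubeT hPd (P.L ^ k) (c + t) fun i => P.L ^ k * M i) →
        (∀ x y, ∑ α, |lam α x y| ≤ 1) → (∀ x y, 0 ≤ ζ'' x y ∧ ζ'' x y ≤ 1) →
      ∀ (h : GaugeTransf P 0 U1) (x : Balaban1983to89.Site P 0) (R R₁ : ℝ), 0 ≤ R → 0 ≤ R₁ →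
        (∀ y, ζ'' x y ≠ 0 → ∑ α, lam α x y = 1) →
        (∀ α y, ζ'' x y * lam α x y ≠ 0 → x ∈ cube α ∧ y ∈ cube α ∧
            ∀ w ∈ cubeT hPd (P.L ^ k) c (fun i => P.L ^ k * M0 i), w ∉ cube α →
              R ≤ B5Ineq137Torus.T P 0 x w ∧ R ≤ B5Ineq137Torus.T P 0 y w) →
        (∀ y, B5Ineq137Torus.T P 0 x y ≤ R₁ → ζ'' x y = 1) →
      ∀ (f : Balaban1983to89.Site P 0 → ℂ) (F D : ℝ), (∀ y, ‖f y‖ ≤ F) → 0 ≤ D → (∀ y, f y ≠ 0 → D ≤ B5Ineq137Torus.T P 0 x y) →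
      ∀ S : Finset ι, (∀ α y, ζ'' x y * lam α x y ≠ 0 → f y ≠ 0 → α ∈ S) →
        ‖(gLocT (B1RG242Torus.α P a k * (P.L : ℝ) ^ (k * P.d)) P.eps⁻¹ (gaugeAct h (1 : GaugeField P 0 U1)) k cube lam ζ'' *ᵥ f) x -
            (gBox (B1RG242Torus.α P a k * (P.L : ℝ) ^ (k * P.d)) P.eps⁻¹ (gaugeAct h (1 : GaugeField P 0 U1)) k
              (cubeT hPd (P.L ^ k) c fun i => P.L ^ k * M0 i) *ᵥ f) x‖ ≤
          c₀ * (S.card * Real.exp (-(δ₀ * (P.eps * (2 * R)))) + Real.exp (-(δ₀ / 2 * (P.eps * R₁)))) *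
            Real.exp (-(δ₀ / 2 * (P.eps * D))) * F := by
  obtain ⟨δ₁, c₁, hδ₁, hc₁, H1⟩ := close112_flat_cube d ℓ hℓ ha
  obtain ⟨δ₂, c₂, hδ₂, hc₂, H2⟩ := decay110_flat_cube d ℓ hℓ ha
  refine ⟨min δ₁ δ₂, max c₁ c₂, lt_min hδ₁ hδ₂, lt_max_of_lt_left hc₁, ?_⟩
  intro P hPd hPL k hk1 hkK c M0 hM0 hfit0 hN0 ι _ cube lam ζ hcube hlam hζ h x R R₁ hR hR₁ hcomp hdeep hcut f F D hF hD hsupp S hS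
  set δ := min δ₁ δ₂ with hδdef
  set C := max c₁ c₂ with hCdef
  have hδ1 : δ ≤ δ₁ := min_le_left _ _
  have hδ2 : δ ≤ δ₂ := min_le_right _ _
  have hδ0 : 0 ≤ δ := (lt_min hδ₁ hδ₂).le
  have hC1 : c₁ ≤ C := le_max_left _ _
  have hC2 : c₂ ≤ C := le_max_right _ _
  have hC0 : 0 ≤ C := hc₁.le.trans hC1
  have hε : 0 < P.eps := P.eps_pos
  have hF0 : 0 ≤ F := (norm_nonneg _).trans (hF x)
  have hζ1 : ∀ y, |ζ x y| ≤ 1 := fun y => abs_le.2 ⟨by linarith [(hζ x y).1], (hζ x y).2⟩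
  set G0 := gBox (B1RG242Torus.α P a k * (P.L : ℝ) ^ (k * P.d)) P.eps⁻¹ (gaugeAct h (1 : GaugeField P 0 U1)) k
    (cubeT hPd (P.L ^ k) c fun i => P.L ^ k * M0 i) with hG0def
  rw [gLocT_sub_mulVec_apply _ _ _ _ cube lam ζ G0 f x hcomp]
  -- the active cubes: (1.11)–(1.12) operator form on the row sources
  set B := c₁ * Real.exp (-(δ₁ * (P.eps * D))) * Real.exp (-(δ₁ * (P.eps * (R + R)))) * F with hBdef
  have hB0 : 0 ≤ B := by positivity
  have hterm : ∀ α, ‖((gBox (B1RG242Torus.α P a k * (P.L : ℝ) ^ (k * P.d)) P.eps⁻¹ (gaugeAct h (1 : GaugeField P 0 U1)) k (cube α) - G0) *ᵥ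
      fun y => (ζ x y : ℂ) * (lam α x y : ℂ) * f y) x‖ ≤ B := by
    intro α
    by_cases hex : ∃ y, ζ x y * lam α x y ≠ 0
    · obtain ⟨y₀, hy₀⟩ := hex
      obtain ⟨hxα, -, hwx⟩ := hdeep α y₀ hy₀
      obtain ⟨t, M, hM, hnest, hc⟩ := hcube α
      have hyα : ∀ y, (ζ x y : ℂ) * (lam α x y : ℂ) * f y ≠ 0 → y ∈ cubeT hPd (P.L ^ k) (c + t) (fun i => P.L ^ k * M i) :=
        fun y hy => hc ▸ (hdeep α y (rowSource_ne_zero hy).1).2.1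
      have hwy : ∀ y, (ζ x y : ℂ) * (lam α x y : ℂ) * f y ≠ 0 →
          ∀ w ∈ cubeT hPd (P.L ^ k) c (fun i => P.L ^ k * M0 i), w ∉ cubeT hPd (P.L ^ k) (c + t) (fun i => P.L ^ k * M i) →
            R ≤ B5Ineq137Torus.T P 0 y w :=
        fun y hy w hw hw' => ((hdeep α y (rowSource_ne_zero hy).1).2.2 w hw (hc ▸ hw')).2
      rw [hc] at hxα hwx
      rw [Matrix.sub_mulVec, Pi.sub_apply, hc]
      exact H1 P hPd hPL k hk1 hkK c M0 t M hM hnest hfit0 hN0 h x hxα _ F D R R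
        (fun y => norm_rowSource_le (hζ1 y) (abs_lam_le_one hlam α x y) hF y)
        (fun y hy => by by_contra hne; exact hy (hyα y hne)) hD (fun y hy => hsupp y (rowSource_ne_zero hy).2)
        hR (fun w hw hw' => (hwx w hw hw').1) hR hwy
    · push Not at hex
      have h0 : (fun y => (ζ x y : ℂ) * (lam α x y : ℂ) * f y) = 0 := by
        funext y; rw [← Complex.ofReal_mul, hex y, Complex.ofReal_zero, zero_mul]; rfl
      rw [h0, mulVec_zero, Pi.zero_apply, norm_zero]
      exact hB0
  have hzero : ∀ α, α ∉ S → ((gBox (B1RG242Torus.α P a k * (P.L : ℝ) ^ (k * P.d)) P.eps⁻¹ (gaugeAct h (1 : GaugeField P 0 U1)) k (cube α)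
      - G0) *ᵥ fun y => (ζ x y : ℂ) * (lam α x y : ℂ) * f y) x = 0 := by
    intro α hα
    have h0 : (fun y => (ζ x y : ℂ) * (lam α x y : ℂ) * f y) = 0 := by
      funext y
      by_contra hne
      exact hα (hS α y (rowSource_ne_zero hne).1 (rowSource_ne_zero hne).2)
    rw [h0, mulVec_zero, Pi.zero_apply]
  have hsum : ‖∑ α, ((gBox (B1RG242Torus.α P a k * (P.L : ℝ) ^ (k * P.d)) P.eps⁻¹ (gaugeAct h (1 : GaugeField P 0 U1)) k (cube α) - G0) *ᵥ
      fun y => (ζ x y : ℂ) * (lam α x y : ℂ) * f y) x‖ ≤ S.card * B := by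
    rw [← Finset.sum_subset (Finset.subset_univ S) (fun α _ hα => hzero α hα)]
    calc ‖∑ α ∈ S, ((gBox (B1RG242Torus.α P a k * (P.L : ℝ) ^ (k * P.d)) P.eps⁻¹ (gaugeAct h (1 : GaugeField P 0 U1)) k (cube α) - G0) *ᵥ
            fun y => (ζ x y : ℂ) * (lam α x y : ℂ) * f y) x‖
        ≤ ∑ α ∈ S, ‖((gBox (B1RG242Torus.α P a k * (P.L : ℝ) ^ (k * P.d)) P.eps⁻¹ (gaugeAct h (1 : GaugeField P 0 U1)) k (cube α) - G0) *ᵥ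
            fun y => (ζ x y : ℂ) * (lam α x y : ℂ) * f y) x‖ := norm_sum_le _ _
      _ ≤ ∑ α ∈ S, B := Finset.sum_le_sum fun α _ => hterm α
      _ = S.card * B := by rw [Finset.sum_const, nsmul_eq_mul]
  -- the tail source `(ζ″ − 1)f` lives beyond `R₁` and beyond `D`: (1.10) on the outer box
  have htail : ‖(G0 *ᵥ fun y => ((ζ x y : ℂ) - 1) * f y) x‖ ≤ c₂ * Real.exp (-(δ₂ * (P.eps * max D R₁))) * F := by
    refine H2 P hPd hPL k hk1 hkK c M0 hM0 hfit0 hN0 h x _ F (max D R₁) (fun y => ?_) (hD.trans (le_max_left _ _)) (fun y hy => ?_)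
    · have hz1 : ‖(ζ x y : ℂ) - 1‖ ≤ 1 := by
        rw [← Complex.ofReal_one, ← Complex.ofReal_sub, Complex.norm_real, Real.norm_eq_abs, abs_le]
        constructor <;> linarith [(hζ x y).1, (hζ x y).2]
      calc ‖((ζ x y : ℂ) - 1) * f y‖ = ‖(ζ x y : ℂ) - 1‖ * ‖f y‖ := norm_mul _ _
        _ ≤ 1 * F := mul_le_mul hz1 (hF y) (norm_nonneg _) zero_le_one
        _ = F := one_mul F
    · have hf : f y ≠ 0 := fun hf => hy (by rw [hf, mul_zero])
      have hz : ζ x y ≠ 1 := fun h1 => hy (by rw [h1]; push_cast; rw [sub_self, zero_mul])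
      refine max_le (hsupp y hf) (le_of_lt (lt_of_not_ge fun hle => hz (hcut y hle)))
  -- assemble
  have hεD : 0 ≤ P.eps * D := mul_nonneg hε.le hD
  have hsum' : (S.card : ℝ) * B ≤ C * (S.card * Real.exp (-(δ * (P.eps * (2 * R))))) * Real.exp (-(δ / 2 * (P.eps * D))) * F := by
    have h1 : B ≤ C * Real.exp (-(δ * (P.eps * (2 * R)))) * Real.exp (-(δ / 2 * (P.eps * D))) * F := by
      rw [hBdef, mul_assoc c₁, mul_comm (Real.exp _) (Real.exp _), ← mul_assoc c₁]
      refine mul_le_mul_of_nonneg_right (mul_le_mul (mul_le_mul hC1 ?_ (Real.exp_pos _).le hC0) ?_ (Real.exp_pos _).le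
        (by positivity)) hF0
      · rw [show R + R = 2 * R by ring]
        exact exp_le_exp_of_rate hδ1 (by positivity)
      · exact exp_le_exp_of_rate (by linarith) hεD
    calc (S.card : ℝ) * B ≤ S.card * (C * Real.exp (-(δ * (P.eps * (2 * R)))) * Real.exp (-(δ / 2 * (P.eps * D))) * F) :=
          mul_le_mul_of_nonneg_left h1 (Nat.cast_nonneg _)
      _ = C * (S.card * Real.exp (-(δ * (P.eps * (2 * R))))) * Real.exp (-(δ / 2 * (P.eps * D))) * F := by ring
  have htail' : c₂ * Real.exp (-(δ₂ * (P.eps * max D R₁))) * F ≤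
      C * Real.exp (-(δ / 2 * (P.eps * R₁))) * Real.exp (-(δ / 2 * (P.eps * D))) * F := by
    refine mul_le_mul_of_nonneg_right ?_ hF0
    rw [mul_assoc C, ← Real.exp_add]
    refine mul_le_mul hC2 (Real.exp_le_exp.2 ?_) (Real.exp_pos _).le hC0
    have hm1 : D ≤ max D R₁ := le_max_left _ _
    have hm2 : R₁ ≤ max D R₁ := le_max_right _ _
    have hm0 : 0 ≤ P.eps * max D R₁ := mul_nonneg hε.le (hD.trans hm1)
    nlinarith [mul_le_mul_of_nonneg_left hm1 hε.le, mul_le_mul_of_nonneg_left hm2 hε.le, mul_nonneg hδ0 hm0,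
      mul_le_mul_of_nonneg_right hδ2 hm0]
  calc ‖∑ α, ((gBox (B1RG242Torus.α P a k * (P.L : ℝ) ^ (k * P.d)) P.eps⁻¹ (gaugeAct h (1 : GaugeField P 0 U1)) k (cube α) - G0) *ᵥ
            fun y => (ζ x y : ℂ) * (lam α x y : ℂ) * f y) x + (G0 *ᵥ fun y => ((ζ x y : ℂ) - 1) * f y) x‖
      ≤ S.card * B + c₂ * Real.exp (-(δ₂ * (P.eps * max D R₁))) * F := (norm_add_le _ _).trans (add_le_add hsum htail)
    _ ≤ C * (S.card * Real.exp (-(δ * (P.eps * (2 * R))))) * Real.exp (-(δ / 2 * (P.eps * D))) * F +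
        C * Real.exp (-(δ / 2 * (P.eps * R₁))) * Real.exp (-(δ / 2 * (P.eps * D))) * F := add_le_add hsum' htail'
    _ = C * (S.card * Real.exp (-(δ * (P.eps * (2 * R)))) + Real.exp (-(δ / 2 * (P.eps * R₁)))) *
        Real.exp (-(δ / 2 * (P.eps * D))) * F := by ring

end Operator

end

end Literature.MathematicalPhysics.QuantumFieldTheory.BalabanImbrieJaffe1984to88.BIJ88NeumannPropagatorFlatClose231
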